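import Literature.AlgebraicGeometry.HodgeTheory.FermatHodgeCharacterTriplePrim
import HarnessLib

/-!
# Four-term configurations annihilated by all primitive characters (Aoki 1983, Prop. 8.2)

Support file XI (everything PROVED; no named facts, no definitions) for the structure theorem of
the Hodge characters of the Fermat surface (`AokiShioda1983_thmB2m_standard`).

The recursion `R(n)` of the peeling calculus (file `Peel`) for configurations of four units
`pᵢ ∈ (ℤ/n)ˣ` with signs `sᵢ = ±1` annihilated by ALL primitive characters mod `n`: peeling one
prime power at a time, such a configuration either SPLITS into two annihilated pairs, or `5 ∥ n`
and the four terms `sᵢ χ₀(pᵢ)` agree for every primitive character `χ₀` mod `n/5`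
(the "`5`-quasi-standard" case of [Aoki1983, Prop. 8.2]).

## References

* [Aoki1983] N. Aoki, On some arithmetic problems related to the Hodge cycles on the Fermat
  varieties, Math. Ann. 266 (1983) 23–54, Prop. 8.2 (text read).
-/

noncomputable section

open Finset

namespace Literature.AlgebraicGeometry.HodgeTheory

namespace FermatCharacter

section Generic

variable {q n : ℕ} [NeZero q] [NeZero n]

omit [NeZero q] [NeZero n] in
/-- The slice sum of a configuration at the residue `r`, as a sum over the indices with that
residue. [folklore] -/
theorem slice_eq_sum_filter {k : ℕ} (p : Fin k → (ZMod (q * n))ˣ) (c : Fin k → ℂ)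
    (χ₂ : DirichletCharacter ℂ n) (r : ZMod q) :
    (∑ i, (if ZMod.castHom (dvd_mul_right q n) (ZMod q) (p i) = r then
        c i * χ₂ (ZMod.castHom (dvd_mul_left n q) (ZMod n) (p i)) else 0)) =
      ∑ i ∈ univ.filter (fun i ↦ ZMod.castHom (dvd_mul_right q n) (ZMod q) (p i) = r),
        c i * χ₂ (ZMod.castHom (dvd_mul_left n q) (ZMod n) (p i)) := by
  classical
  rw [Finset.sum_filter]

/-- **Free residue ⟹ the slice is null** (filter form). [cite: Aoki1983, Cor. 3.4] -/
theorem sum_filter_eq_zero_of_free (h : q.Coprime n) {d : ℕ} (hd : d ∣ q)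
    (hprim : ∀ χ : DirichletCharacter ℂ q, ¬ χ.FactorsThrough d → χ.IsPrimitive)
    {k : ℕ} (p : Fin k → (ZMod (q * n))ˣ) (c : Fin k → ℂ)
    (hT : ∀ χ : DirichletCharacter ℂ (q * n), χ.IsPrimitive → ∑ i, c i * χ (p i) = 0)
    (r u : (ZMod q)ˣ) (hu : ZMod.unitsMap hd u = 1)
    (hfree : ∀ i, ZMod.castHom (dvd_mul_right q n) (ZMod q) (p i) ≠ (u : ZMod q) * r)
    (χ₂ : DirichletCharacter ℂ n) (hχ₂ : χ₂.IsPrimitive) :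
    ∑ i ∈ univ.filter (fun i ↦ ZMod.castHom (dvd_mul_right q n) (ZMod q) (p i) = r),
        c i * χ₂ (ZMod.castHom (dvd_mul_left n q) (ZMod n) (p i)) = 0 := by
  rw [← slice_eq_sum_filter]
  exact slice_null_of_free h hd hprim p c hT r u hu hfree χ₂ hχ₂

/-- **Peel** (filter form): slices at `u y` and `y` agree for `u` in the kernel.
[cite: Aoki1983, Cor. 3.4] -/
theorem sum_filter_mul_eq (h : q.Coprime n) {d : ℕ} (hd : d ∣ q)
    (hprim : ∀ χ : DirichletCharacter ℂ q, ¬ χ.FactorsThrough d → χ.IsPrimitive)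
    {k : ℕ} (p : Fin k → (ZMod (q * n))ˣ) (c : Fin k → ℂ)
    (hT : ∀ χ : DirichletCharacter ℂ (q * n), χ.IsPrimitive → ∑ i, c i * χ (p i) = 0)
    (χ₂ : DirichletCharacter ℂ n) (hχ₂ : χ₂.IsPrimitive)
    (u y : (ZMod q)ˣ) (hu : ZMod.unitsMap hd u = 1) :
    ∑ i ∈ univ.filter (fun i ↦ ZMod.castHom (dvd_mul_right q n) (ZMod q) (p i) = (u : ZMod q) * y),
        c i * χ₂ (ZMod.castHom (dvd_mul_left n q) (ZMod n) (p i)) =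
      ∑ i ∈ univ.filter (fun i ↦ ZMod.castHom (dvd_mul_right q n) (ZMod q) (p i) = y),
        c i * χ₂ (ZMod.castHom (dvd_mul_left n q) (ZMod n) (p i)) := by
  rw [← slice_eq_sum_filter, ← slice_eq_sum_filter]
  exact slice_invariant h hd hprim p c hT χ₂ hχ₂ u y hu

/-- A single non-vanishing term is not a null configuration: if the residue class of `i` is
`{i}` and free, contradiction. [cite: Aoki1983, Cor. 3.4] -/
theorem false_of_singleton_free (h : q.Coprime n) {d : ℕ} (hd : d ∣ q)
    (hprim : ∀ χ : DirichletCharacter ℂ q, ¬ χ.FactorsThrough d → χ.IsPrimitive)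
    (hval : Odd n ∨ 4 ∣ n)
    {k : ℕ} (p : Fin k → (ZMod (q * n))ˣ) (c : Fin k → ℂ) (hc : ∀ i, c i ≠ 0)
    (hT : ∀ χ : DirichletCharacter ℂ (q * n), χ.IsPrimitive → ∑ i, c i * χ (p i) = 0)
    (i : Fin k)
    (hsingle : ∀ j, ZMod.castHom (dvd_mul_right q n) (ZMod q) (p j) =
      ZMod.castHom (dvd_mul_right q n) (ZMod q) (p i) → j = i)
    (u : (ZMod q)ˣ) (hu : ZMod.unitsMap hd u = 1)
    (hfree : ∀ j, ZMod.castHom (dvd_mul_right q n) (ZMod q) (p j) ≠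
      (u : ZMod q) * ZMod.castHom (dvd_mul_right q n) (ZMod q) (p i)) : False := by
  classical
  obtain ⟨χ₂, hχ₂⟩ := exists_isPrimitive (n := n) hval
  have key := sum_filter_eq_zero_of_free h hd hprim p c hT
    (ZMod.unitsMap (dvd_mul_right q n) (p i)) u hu (by rw [coe_unitsMap]; exact hfree) χ₂ hχ₂
  have hset : univ.filter (fun j ↦ ZMod.castHom (dvd_mul_right q n) (ZMod q) (p j) =
      ((ZMod.unitsMap (dvd_mul_right q n) (p i) : (ZMod q)ˣ) : ZMod q)) = {i} := by
    ext j
    simp only [mem_filter, mem_univ, true_and, mem_singleton, coe_unitsMap]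
    exact ⟨hsingle j, fun h ↦ by rw [h]⟩
  rw [hset, Finset.sum_singleton] at key
  rcases mul_eq_zero.mp key with h0 | h0
  · exact hc i h0
  · have := DirichletCharacter.unit_norm_eq_one χ₂ (ZMod.unitsMap (dvd_mul_left n q) (p i))
    rw [coe_unitsMap, h0, norm_zero] at this
    exact zero_ne_one this

/-- **Lifting a pair with equal residues.** If `pᵢ ≡ pⱼ (mod q)` and the two-term relation holds
at level `n`, it holds at level `q n`. [cite: Aoki1983, §4] -/
theorem pair_null_of_same_residue (h : q.Coprime n) {d : ℕ} (hd : d ∣ q) (hdq : d ≠ q)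
    (pi pj : (ZMod (q * n))ˣ) (ci cj : ℂ)
    (hres : ZMod.castHom (dvd_mul_right q n) (ZMod q) (pi : ZMod (q * n)) =
      ZMod.castHom (dvd_mul_right q n) (ZMod q) (pj : ZMod (q * n)))
    (hrel : ∀ χ₂ : DirichletCharacter ℂ n, χ₂.IsPrimitive →
      ci * χ₂ (ZMod.castHom (dvd_mul_left n q) (ZMod n) (pi : ZMod (q * n))) +
        cj * χ₂ (ZMod.castHom (dvd_mul_left n q) (ZMod n) (pj : ZMod (q * n))) = 0)
    (χ : DirichletCharacter ℂ (q * n)) (hχ : χ.IsPrimitive) : ci * χ pi + cj * χ pj = 0 := by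
  classical
  have := null_of_slice_invariant h hd hdq ![pi, pj] ![ci, cj] ?_ χ hχ
  · simpa [Fin.sum_univ_two] using this
  intro χ₂ hχ₂ u y hu
  -- both slices vanish identically: the slice function is supported at the common residue,
  -- where it equals the two-term relation
  have hslice : ∀ r : ZMod q, (∑ i : Fin 2, (if ZMod.castHom (dvd_mul_right q n) (ZMod q)
      ((![pi, pj] i : (ZMod (q * n))ˣ)) = r then ![ci, cj] i * χ₂ (ZMod.castHom (dvd_mul_left n q)
        (ZMod n) ((![pi, pj] i : (ZMod (q * n))ˣ))) else 0)) = 0 := by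
    intro r
    simp only [Fin.sum_univ_two, Matrix.cons_val_zero, Matrix.cons_val_one]
    by_cases hr : ZMod.castHom (dvd_mul_right q n) (ZMod q) (pi : ZMod (q * n)) = r
    · rw [if_pos hr, if_pos (hres ▸ hr)]
      exact hrel χ₂ hχ₂
    · rw [if_neg hr, if_neg (fun h' ↦ hr (hres.trans h')), add_zero]
  rw [hslice, hslice]

/-- **Lifting a pair across a two-element kernel.** If the kernel is `{1, u}`, `pⱼ ≡ u pᵢ (mod q)`
and `cᵢ χ₂(pᵢ') = cⱼ χ₂(pⱼ')` for all primitive `χ₂` mod `n` (the slices at `pᵢ` and `u pᵢ`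
agree), then the pair relation `cᵢ χ(pᵢ) + ... ` — precisely `cᵢ χ(pᵢ) - cⱼ χ(pⱼ) = 0`... we state
the general form with an arbitrary coefficient `cⱼ'` at level `q n` related by `cⱼ' = -cⱼ`:
`cᵢ χ(pᵢ) + cⱼ' χ(pⱼ) = 0` whenever `cᵢ χ₂(pᵢ') + cⱼ' ... `. To keep it usable we phrase it as:
the configuration `(cᵢ, pᵢ), (cⱼ, pⱼ)` is null at level `qn` provided its two slices AGREE.
[cite: Aoki1983, §4] -/
theorem pair_null_of_coset (h : q.Coprime n) {d : ℕ} (hd : d ∣ q) (hdq : d ≠ q)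
    (u : (ZMod q)ˣ) (hu : ZMod.unitsMap hd u = 1)
    (hker : ∀ v : (ZMod q)ˣ, ZMod.unitsMap hd v = 1 → v = 1 ∨ v = u)
    (pi pj : (ZMod (q * n))ˣ) (ci cj : ℂ)
    (hres : ZMod.castHom (dvd_mul_right q n) (ZMod q) (pj : ZMod (q * n)) =
      (u : ZMod q) * ZMod.castHom (dvd_mul_right q n) (ZMod q) (pi : ZMod (q * n)))
    (hu1 : (u : ZMod q) ≠ 1)
    (hrel : ∀ χ₂ : DirichletCharacter ℂ n, χ₂.IsPrimitive →
      ci * χ₂ (ZMod.castHom (dvd_mul_left n q) (ZMod n) (pi : ZMod (q * n))) =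
        cj * χ₂ (ZMod.castHom (dvd_mul_left n q) (ZMod n) (pj : ZMod (q * n))))
    (χ : DirichletCharacter ℂ (q * n)) (hχ : χ.IsPrimitive) : ci * χ pi + cj * χ pj = 0 := by
  classical
  have hu2 : u * u = 1 := by
    rcases hker (u * u) (by rw [map_mul, hu, one_mul]) with h1 | h1
    · exact h1
    · exact absurd (mul_left_cancel (a := u) (h1.trans (mul_one u).symm)) (fun h ↦ hu1 (by rw [h, Units.val_one]))
  have := null_of_slice_invariant h hd hdq ![pi, pj] ![ci, cj] ?_ χ hχ
  · simpa [Fin.sum_univ_two] using this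
  intro χ₂ hχ₂ v y hv
  set ri := ZMod.castHom (dvd_mul_right q n) (ZMod q) (pi : ZMod (q * n)) with hri
  have hrij : ZMod.castHom (dvd_mul_right q n) (ZMod q) (pj : ZMod (q * n)) = u * ri := hres
  have hriu : IsUnit ri := by rw [hri]; exact (Units.isUnit pi).map _
  have hne : (u : ZMod q) * ri ≠ ri := by
    intro he
    apply hu1
    exact hriu.mul_right_cancel (he.trans (one_mul ri).symm)
  -- the slice function `G`
  have hG : ∀ r : ZMod q, (∑ i : Fin 2, (if ZMod.castHom (dvd_mul_right q n) (ZMod q)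
      ((![pi, pj] i : (ZMod (q * n))ˣ)) = r then ![ci, cj] i * χ₂ (ZMod.castHom (dvd_mul_left n q)
        (ZMod n) ((![pi, pj] i : (ZMod (q * n))ˣ))) else 0)) =
      (if ri = r then ci * χ₂ (ZMod.castHom (dvd_mul_left n q) (ZMod n) (pi : ZMod (q * n))) else 0) +
      (if (u : ZMod q) * ri = r then cj * χ₂ (ZMod.castHom (dvd_mul_left n q) (ZMod n) (pj : ZMod (q * n)))
        else 0) := by
    intro r
    simp only [Fin.sum_univ_two, Matrix.cons_val_zero, Matrix.cons_val_one, ← hri, hrij]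
  rw [hG, hG]
  rcases hker v hv with h1 | h1
  · rw [h1, Units.val_one, one_mul]
  · rw [h1]
    -- `v = u`: compare the values at `y` and `u y` using `u² = 1`
    have huu : (u : ZMod q) * ((u : ZMod q) * y) = y := by
      rw [← mul_assoc, ← Units.val_mul, hu2, Units.val_one, one_mul]
    have hUu : IsUnit (u : ZMod q) := Units.isUnit u
    by_cases h1 : ri = (u : ZMod q) * y
    · have h2 : (u : ZMod q) * ri = y := by rw [h1, huu]
      have h3 : ri ≠ y := fun h ↦ hne (by rw [h2, h])
      have h4 : (u : ZMod q) * ri ≠ (u : ZMod q) * y := fun h ↦ h3 (hUu.mul_left_cancel h)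
      rw [if_pos h1, if_neg h4, if_neg h3, if_pos h2, add_zero, zero_add]
      exact hrel χ₂ hχ₂
    · by_cases h2 : (u : ZMod q) * ri = (u : ZMod q) * y
      · have h2' : ri = y := hUu.mul_left_cancel h2
        have h3 : (u : ZMod q) * ri ≠ y := fun h ↦ hne (by rw [h, h2'])
        rw [if_neg h1, if_pos h2, if_pos h2', if_neg h3, zero_add, add_zero]
        exact (hrel χ₂ hχ₂).symm
      · have h3 : ri ≠ y := fun h ↦ h2 (by rw [h])
        have h4 : (u : ZMod q) * ri ≠ y := fun h ↦ h1 (by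
          rw [← h, ← mul_assoc, ← Units.val_mul, hu2, Units.val_one, one_mul])
        rw [if_neg h1, if_neg h2, if_neg h3, if_neg h4]

end Generic

/-! ### The branch with all residue classes free -/

section Free

variable {q n : ℕ} [NeZero q] [NeZero n]

/-- A residue class `{m}` consisting of a single index is contradictory when free.
[cite: Aoki1983, Prop. 8.2] -/
theorem quad_false_of_single (h : q.Coprime n) {d : ℕ} (hd : d ∣ q)
    (hprim : ∀ χ : DirichletCharacter ℂ q, ¬ χ.FactorsThrough d → χ.IsPrimitive)
    (hval : Odd n ∨ 4 ∣ n) (p : Fin 4 → (ZMod (q * n))ˣ) (s : Fin 4 → ℂ)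
    (hs : ∀ i, s i = 1 ∨ s i = -1)
    (hT : ∀ χ : DirichletCharacter ℂ (q * n), χ.IsPrimitive → ∑ i, s i * χ (p i) = 0)
    (hfree : ∀ i, ∃ u : (ZMod q)ˣ, ZMod.unitsMap hd u = 1 ∧
      ∀ j, ZMod.castHom (dvd_mul_right q n) (ZMod q) (p j) ≠
        (u : ZMod q) * ZMod.castHom (dvd_mul_right q n) (ZMod q) (p i))
    (m : Fin 4) (hm : ∀ j, j ≠ m → ZMod.castHom (dvd_mul_right q n) (ZMod q) (p j) ≠
      ZMod.castHom (dvd_mul_right q n) (ZMod q) (p m)) : False := by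
  obtain ⟨u, hu, hfu⟩ := hfree m
  refine false_of_singleton_free h hd hprim hval p s (fun i h0 ↦ ?_) hT m
    (fun j hj ↦ by by_contra hjm; exact hm j hjm hj) u hu hfu
  rcases hs i with h1 | h1 <;> rw [h1] at h0 <;> norm_num at h0

/-- The null slice of a free residue class, as an explicit relation over the class.
[cite: Aoki1983, Prop. 8.2] -/
theorem quad_slice_null (h : q.Coprime n) {d : ℕ} (hd : d ∣ q)
    (hprim : ∀ χ : DirichletCharacter ℂ q, ¬ χ.FactorsThrough d → χ.IsPrimitive)
    (p : Fin 4 → (ZMod (q * n))ˣ) (s : Fin 4 → ℂ)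
    (hT : ∀ χ : DirichletCharacter ℂ (q * n), χ.IsPrimitive → ∑ i, s i * χ (p i) = 0)
    (i : Fin 4) (u : (ZMod q)ˣ) (hu : ZMod.unitsMap hd u = 1)
    (hfu : ∀ j, ZMod.castHom (dvd_mul_right q n) (ZMod q) (p j) ≠
        (u : ZMod q) * ZMod.castHom (dvd_mul_right q n) (ZMod q) (p i))
    (χ₂ : DirichletCharacter ℂ n) (hχ₂ : χ₂.IsPrimitive) :
    ∑ j ∈ univ.filter (fun j ↦ ZMod.castHom (dvd_mul_right q n) (ZMod q) (p j) =
        ZMod.castHom (dvd_mul_right q n) (ZMod q) (p i)),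
      s j * χ₂ (ZMod.castHom (dvd_mul_left n q) (ZMod n) (p j)) = 0 := by
  have := sum_filter_eq_zero_of_free h hd hprim p s hT (ZMod.unitsMap (dvd_mul_right q n) (p i))
    u hu (by rw [coe_unitsMap]; exact hfu) χ₂ hχ₂
  rwa [coe_unitsMap] at this

/-- The `(2,2)` pattern: the class of `0` is `{0, j}` and `pₖ ≡ pₗ`: the configuration splits
into the two annihilated pairs `{0, j}`, `{k, l}` at level `q n`. [cite: Aoki1983, Prop. 8.2] -/
theorem quad_split_of_two_two (h : q.Coprime n) {d : ℕ} (hd : d ∣ q) (hdq : d ≠ q)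
    (hprim : ∀ χ : DirichletCharacter ℂ q, ¬ χ.FactorsThrough d → χ.IsPrimitive)
    (p : Fin 4 → (ZMod (q * n))ˣ) (s : Fin 4 → ℂ)
    (hT : ∀ χ : DirichletCharacter ℂ (q * n), χ.IsPrimitive → ∑ i, s i * χ (p i) = 0)
    (hfree : ∀ i, ∃ u : (ZMod q)ˣ, ZMod.unitsMap hd u = 1 ∧
      ∀ j, ZMod.castHom (dvd_mul_right q n) (ZMod q) (p j) ≠
        (u : ZMod q) * ZMod.castHom (dvd_mul_right q n) (ZMod q) (p i))
    (j k l : Fin 4) (h0j : (0 : Fin 4) ≠ j) (h0k : (0 : Fin 4) ≠ k) (h0l : (0 : Fin 4) ≠ l)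
    (hjk : j ≠ k) (hjl : j ≠ l) (hkl : k ≠ l)
    (hj : ZMod.castHom (dvd_mul_right q n) (ZMod q) (p j) =
      ZMod.castHom (dvd_mul_right q n) (ZMod q) (p 0))
    (hk : ZMod.castHom (dvd_mul_right q n) (ZMod q) (p k) ≠
      ZMod.castHom (dvd_mul_right q n) (ZMod q) (p 0))
    (hl : ZMod.castHom (dvd_mul_right q n) (ZMod q) (p l) ≠
      ZMod.castHom (dvd_mul_right q n) (ZMod q) (p 0))
    (hkl' : ZMod.castHom (dvd_mul_right q n) (ZMod q) (p k) =
      ZMod.castHom (dvd_mul_right q n) (ZMod q) (p l)) :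
    (∀ χ : DirichletCharacter ℂ (q * n), χ.IsPrimitive → s 0 * χ (p 0) + s j * χ (p j) = 0) ∧
    (∀ χ : DirichletCharacter ℂ (q * n), χ.IsPrimitive → s k * χ (p k) + s l * χ (p l) = 0) := by
  classical
  have huniv : ∀ x : Fin 4, x = 0 ∨ x = j ∨ x = k ∨ x = l := by
    intro x
    -- four distinct elements of `Fin 4` exhaust it
    have hcard : ({0, j, k, l} : Finset (Fin 4)) = univ := by
      apply Finset.eq_univ_of_card
      rw [Finset.card_insert_of_notMem, Finset.card_insert_of_notMem, Finset.card_pair hkl]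
      · simp
      · simp only [Finset.mem_insert, Finset.mem_singleton, not_or]; exact ⟨hjk, hjl⟩
      · simp only [Finset.mem_insert, Finset.mem_singleton, not_or]; exact ⟨h0j, h0k, h0l⟩
    have hx : x ∈ ({0, j, k, l} : Finset (Fin 4)) := by rw [hcard]; exact mem_univ x
    simpa only [Finset.mem_insert, Finset.mem_singleton] using hx
  constructor
  · -- the class of `0` is `{0, j}`
    obtain ⟨u, hu, hfu⟩ := hfree 0
    have hset : univ.filter (fun x ↦ ZMod.castHom (dvd_mul_right q n) (ZMod q) (p x) =
        ZMod.castHom (dvd_mul_right q n) (ZMod q) (p 0)) = {0, j} := by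
      ext x
      simp only [mem_filter, mem_univ, true_and, Finset.mem_insert, Finset.mem_singleton]
      constructor
      · intro hx
        rcases huniv x with rfl | rfl | rfl | rfl
        · exact Or.inl rfl
        · exact Or.inr rfl
        · exact absurd hx hk
        · exact absurd hx hl
      · rintro (rfl | rfl)
        · rfl
        · exact hj
    intro χ hχ
    refine pair_null_of_same_residue h hd hdq (p 0) (p j) (s 0) (s j) hj.symm (fun χ₂ hχ₂ ↦ ?_) χ hχ
    have := quad_slice_null h hd hprim p s hT 0 u hu hfu χ₂ hχ₂
    rwa [hset, Finset.sum_pair h0j] at this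
  · -- the class of `k` is `{k, l}`
    obtain ⟨u, hu, hfu⟩ := hfree k
    have hset : univ.filter (fun x ↦ ZMod.castHom (dvd_mul_right q n) (ZMod q) (p x) =
        ZMod.castHom (dvd_mul_right q n) (ZMod q) (p k)) = {k, l} := by
      ext x
      simp only [mem_filter, mem_univ, true_and, Finset.mem_insert, Finset.mem_singleton]
      constructor
      · intro hx
        rcases huniv x with rfl | rfl | rfl | rfl
        · exact absurd hx.symm hk
        · exact absurd (hj.symm.trans hx).symm hk
        · exact Or.inl rfl
        · exact Or.inr rfl
      · rintro (rfl | rfl)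
        · rfl
        · exact hkl'.symm
    intro χ hχ
    refine pair_null_of_same_residue h hd hdq (p k) (p l) (s k) (s l) hkl' (fun χ₂ hχ₂ ↦ ?_) χ hχ
    have := quad_slice_null h hd hprim p s hT k u hu hfu χ₂ hχ₂
    rwa [hset, Finset.sum_pair hkl] at this

/-- **The free branch.** If every residue class mod `q` of the four points is free, then either
all four points are congruent mod `q` and the configuration of avatars is null at level `n`, or
the configuration splits into two annihilated pairs at level `q n`.
[cite: Aoki1983, Prop. 8.2] -/
theorem quad_step_free (h : q.Coprime n) {d : ℕ} (hd : d ∣ q) (hdq : d ≠ q)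
    (hprim : ∀ χ : DirichletCharacter ℂ q, ¬ χ.FactorsThrough d → χ.IsPrimitive)
    (hval : Odd n ∨ 4 ∣ n) (p : Fin 4 → (ZMod (q * n))ˣ) (s : Fin 4 → ℂ)
    (hs : ∀ i, s i = 1 ∨ s i = -1)
    (hT : ∀ χ : DirichletCharacter ℂ (q * n), χ.IsPrimitive → ∑ i, s i * χ (p i) = 0)
    (hfree : ∀ i, ∃ u : (ZMod q)ˣ, ZMod.unitsMap hd u = 1 ∧
      ∀ j, ZMod.castHom (dvd_mul_right q n) (ZMod q) (p j) ≠
        (u : ZMod q) * ZMod.castHom (dvd_mul_right q n) (ZMod q) (p i)) :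
    ((∀ i, ZMod.castHom (dvd_mul_right q n) (ZMod q) (p i) =
        ZMod.castHom (dvd_mul_right q n) (ZMod q) (p 0)) ∧
      ∀ χ₂ : DirichletCharacter ℂ n, χ₂.IsPrimitive →
        ∑ i, s i * χ₂ ((ZMod.unitsMap (dvd_mul_left n q) (p i) : (ZMod n)ˣ) : ZMod n) = 0) ∨
    (∃ i j k l : Fin 4, i ≠ j ∧ i ≠ k ∧ i ≠ l ∧ j ≠ k ∧ j ≠ l ∧ k ≠ l ∧
      (∀ χ : DirichletCharacter ℂ (q * n), χ.IsPrimitive → s i * χ (p i) + s j * χ (p j) = 0) ∧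
      (∀ χ : DirichletCharacter ℂ (q * n), χ.IsPrimitive → s k * χ (p k) + s l * χ (p l) = 0)) := by
  classical
  -- abbreviations for the residues
  set r : Fin 4 → ZMod q := fun i ↦ ZMod.castHom (dvd_mul_right q n) (ZMod q) (p i) with hr
  have single := fun (m : Fin 4) (hm : ∀ j, j ≠ m → r j ≠ r m) ↦
    quad_false_of_single h hd hprim hval p s hs hT hfree m hm
  have pair22 := fun (j k l : Fin 4) ↦ quad_split_of_two_two h hd hdq hprim p s hT hfree j k l
  by_cases h1 : r 1 = r 0 <;> by_cases h2 : r 2 = r 0 <;> by_cases h3 : r 3 = r 0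
  · -- all equal
    left
    refine ⟨fun i ↦ ?_, fun χ₂ hχ₂ ↦ ?_⟩
    · fin_cases i
      · rfl
      · exact h1
      · exact h2
      · exact h3
    · obtain ⟨u, hu, hfu⟩ := hfree 0
      have := quad_slice_null h hd hprim p s hT 0 u hu hfu χ₂ hχ₂
      rw [Finset.filter_true_of_mem] at this
      · simpa only [coe_unitsMap] using this
      · intro i _; fin_cases i
        · rfl
        · exact h1
        · exact h2
        · exact h3
  · exfalso; refine single 3 fun j hj ↦ ?_
    fin_cases j
    · exact fun h' ↦ h3 h'.symm
    · exact fun h' ↦ h3 (h'.symm.trans h1)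
    · exact fun h' ↦ h3 (h'.symm.trans h2)
    · exact absurd rfl hj
  · exfalso; refine single 2 fun j hj ↦ ?_
    fin_cases j
    · exact fun h' ↦ h2 h'.symm
    · exact fun h' ↦ h2 (h'.symm.trans h1)
    · exact absurd rfl hj
    · exact fun h' ↦ h2 (h'.symm.trans h3)
  · -- class of `0` is `{0, 1}`
    by_cases h23 : r 2 = r 3
    · right
      obtain ⟨hp1, hp2⟩ := pair22 1 2 3 (by decide) (by decide) (by decide) (by decide) (by decide)
        (by decide) h1 h2 h3 h23
      exact ⟨0, 1, 2, 3, by decide, by decide, by decide, by decide, by decide, by decide, hp1, hp2⟩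
    · exfalso; refine single 2 fun j hj ↦ ?_
      fin_cases j
      · exact fun h' ↦ h2 h'.symm
      · exact fun h' ↦ h2 (h'.symm.trans h1)
      · exact absurd rfl hj
      · exact fun h' ↦ h23 h'.symm
  · exfalso; refine single 1 fun j hj ↦ ?_
    fin_cases j
    · exact fun h' ↦ h1 h'.symm
    · exact absurd rfl hj
    · exact fun h' ↦ h1 (h'.symm.trans h2)
    · exact fun h' ↦ h1 (h'.symm.trans h3)
  · -- class of `0` is `{0, 2}`
    by_cases h13 : r 1 = r 3
    · right
      obtain ⟨hp1, hp2⟩ := pair22 2 1 3 (by decide) (by decide) (by decide) (by decide) (by decide)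
        (by decide) h2 h1 h3 h13
      exact ⟨0, 2, 1, 3, by decide, by decide, by decide, by decide, by decide, by decide, hp1, hp2⟩
    · exfalso; refine single 1 fun j hj ↦ ?_
      fin_cases j
      · exact fun h' ↦ h1 h'.symm
      · exact absurd rfl hj
      · exact fun h' ↦ h1 (h'.symm.trans h2)
      · exact fun h' ↦ h13 h'.symm
  · -- class of `0` is `{0, 3}`
    by_cases h12 : r 1 = r 2
    · right
      obtain ⟨hp1, hp2⟩ := pair22 3 1 2 (by decide) (by decide) (by decide) (by decide) (by decide)
        (by decide) h3 h1 h2 h12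
      exact ⟨0, 3, 1, 2, by decide, by decide, by decide, by decide, by decide, by decide, hp1, hp2⟩
    · exfalso; refine single 1 fun j hj ↦ ?_
      fin_cases j
      · exact fun h' ↦ h1 h'.symm
      · exact absurd rfl hj
      · exact fun h' ↦ h12 h'.symm
      · exact fun h' ↦ h1 (h'.symm.trans h3)
  · exfalso; refine single 0 fun j hj ↦ ?_
    fin_cases j
    · exact absurd rfl hj
    · exact h1
    · exact h2
    · exact h3

end Free

/-! ### Transport of the conclusions from level `n` to level `q n` -/

section Transport

variable {q n : ℕ} [NeZero q] [NeZero n]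

/-- Transport of an annihilated pair through a concentrated peel (all residues equal).
[cite: Aoki1983, §4] -/
theorem quad_pair_lift_conc (h : q.Coprime n) {d : ℕ} (hd : d ∣ q) (hdq : d ≠ q)
    (p : Fin 4 → (ZMod (q * n))ˣ) (s : Fin 4 → ℂ)
    (hconc : ∀ i, ZMod.castHom (dvd_mul_right q n) (ZMod q) (p i) =
      ZMod.castHom (dvd_mul_right q n) (ZMod q) (p 0))
    (i j : Fin 4)
    (hrel : ∀ χ₂ : DirichletCharacter ℂ n, χ₂.IsPrimitive →
      s i * χ₂ ((ZMod.unitsMap (dvd_mul_left n q) (p i) : (ZMod n)ˣ) : ZMod n) +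
        s j * χ₂ ((ZMod.unitsMap (dvd_mul_left n q) (p j) : (ZMod n)ˣ) : ZMod n) = 0)
    (χ : DirichletCharacter ℂ (q * n)) (hχ : χ.IsPrimitive) : s i * χ (p i) + s j * χ (p j) = 0 :=
  pair_null_of_same_residue h hd hdq (p i) (p j) (s i) (s j) ((hconc i).trans (hconc j).symm)
    (fun χ₂ hχ₂ ↦ by simpa only [coe_unitsMap] using hrel χ₂ hχ₂) χ hχ

/-- Transport of an annihilated pair through a peel with a flip set (kernel `{1, u}`, residues
`r₀` or `u r₀`, signs flipped on the latter). [cite: Aoki1983, §4] -/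
theorem quad_pair_lift_flip (h : q.Coprime n) {d : ℕ} (hd : d ∣ q) (hdq : d ≠ q)
    (u : (ZMod q)ˣ) (hu : ZMod.unitsMap hd u = 1) (hu1 : (u : ZMod q) ≠ 1)
    (hker : ∀ v : (ZMod q)ˣ, ZMod.unitsMap hd v = 1 → v = 1 ∨ v = u)
    (p : Fin 4 → (ZMod (q * n))ˣ) (s s' : Fin 4 → ℂ)
    (hres : ∀ i, (ZMod.castHom (dvd_mul_right q n) (ZMod q) (p i) =
        ZMod.castHom (dvd_mul_right q n) (ZMod q) (p 0) ∧ s' i = s i) ∨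
      (ZMod.castHom (dvd_mul_right q n) (ZMod q) (p i) =
        (u : ZMod q) * ZMod.castHom (dvd_mul_right q n) (ZMod q) (p 0) ∧ s' i = -s i))
    (i j : Fin 4)
    (hrel : ∀ χ₂ : DirichletCharacter ℂ n, χ₂.IsPrimitive →
      s' i * χ₂ ((ZMod.unitsMap (dvd_mul_left n q) (p i) : (ZMod n)ˣ) : ZMod n) +
        s' j * χ₂ ((ZMod.unitsMap (dvd_mul_left n q) (p j) : (ZMod n)ˣ) : ZMod n) = 0)
    (χ : DirichletCharacter ℂ (q * n)) (hχ : χ.IsPrimitive) : s i * χ (p i) + s j * χ (p j) = 0 := by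
  have hu2 : (u : ZMod q) * (u : ZMod q) = 1 := by
    rcases hker (u * u) (by rw [map_mul, hu, one_mul]) with h1 | h1
    · rw [← Units.val_mul, h1, Units.val_one]
    · exfalso; apply hu1
      have := mul_left_cancel (a := u) (h1.trans (mul_one u).symm)
      rw [this, Units.val_one]
  rcases hres i with ⟨hri, hsi⟩ | ⟨hri, hsi⟩ <;> rcases hres j with ⟨hrj, hsj⟩ | ⟨hrj, hsj⟩
  · exact pair_null_of_same_residue h hd hdq (p i) (p j) (s i) (s j) (hri.trans hrj.symm)
      (fun χ₂ hχ₂ ↦ by simpa only [coe_unitsMap, hsi, hsj] using hrel χ₂ hχ₂) χ hχ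
  · exact pair_null_of_coset h hd hdq u hu hker (p i) (p j) (s i) (s j) (by rw [hrj, hri]) hu1
      (fun χ₂ hχ₂ ↦ by
        have := hrel χ₂ hχ₂
        rw [hsi, hsj, coe_unitsMap, coe_unitsMap] at this
        linear_combination this) χ hχ
  · have key := pair_null_of_coset h hd hdq u hu hker (p i) (p j) (s i) (s j)
      (by rw [hrj, hri, ← mul_assoc, hu2, one_mul]) hu1
      (fun χ₂ hχ₂ ↦ by
        have := hrel χ₂ hχ₂
        rw [hsi, hsj, coe_unitsMap, coe_unitsMap] at this
        linear_combination -this) χ hχ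
    exact key
  · exact pair_null_of_same_residue h hd hdq (p i) (p j) (s i) (s j) (hri.trans hrj.symm)
      (fun χ₂ hχ₂ ↦ by
        have := hrel χ₂ hχ₂
        rw [hsi, hsj, coe_unitsMap, coe_unitsMap] at this
        linear_combination -this) χ hχ

/-- Transport of the `5`-terminal conclusion through one peel (concentrated or with a flip set
on which every primitive character mod `q` changes sign). [cite: Aoki1983, Prop. 8.2] -/
theorem quad_five_lift (h : q.Coprime n) (u : (ZMod q)ˣ)
    (p : Fin 4 → (ZMod (q * n))ˣ) (s s' : Fin 4 → ℂ)
    (hres : ∀ i, (ZMod.castHom (dvd_mul_right q n) (ZMod q) (p i) =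
        ZMod.castHom (dvd_mul_right q n) (ZMod q) (p 0) ∧ s' i = s i) ∨
      (ZMod.castHom (dvd_mul_right q n) (ZMod q) (p i) =
        (u : ZMod q) * ZMod.castHom (dvd_mul_right q n) (ZMod q) (p 0) ∧ s' i = -s i ∧
        ∀ χ₁ : DirichletCharacter ℂ q, χ₁.IsPrimitive → χ₁ u = -1))
    (hfive : ∃ n₅ : ℕ, n = 5 * n₅ ∧ ¬ 5 ∣ n₅ ∧ ∀ (hd5 : n₅ ∣ n) (χ₀ : DirichletCharacter ℂ n₅),
      χ₀.IsPrimitive → ∀ i j : Fin 4,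
        s' i * χ₀ (ZMod.castHom hd5 (ZMod n₅) ((ZMod.unitsMap (dvd_mul_left n q) (p i) :
          (ZMod n)ˣ) : ZMod n)) =
        s' j * χ₀ (ZMod.castHom hd5 (ZMod n₅) ((ZMod.unitsMap (dvd_mul_left n q) (p j) :
          (ZMod n)ˣ) : ZMod n))) :
    ∃ N₅ : ℕ, q * n = 5 * N₅ ∧ ¬ 5 ∣ N₅ ∧ ∀ (hd : N₅ ∣ q * n) (χ : DirichletCharacter ℂ N₅),
      χ.IsPrimitive → ∀ i j : Fin 4,
        s i * χ (ZMod.castHom hd (ZMod N₅) (p i)) = s j * χ (ZMod.castHom hd (ZMod N₅) (p j)) := by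
  classical
  obtain ⟨n₅, hn, h5, H⟩ := hfive
  have hn₅0 : n₅ ≠ 0 := fun h0 ↦ NeZero.ne n (by rw [hn, h0, mul_zero])
  haveI : NeZero n₅ := ⟨hn₅0⟩
  haveI : NeZero (q * n₅) := ⟨mul_ne_zero (NeZero.ne q) hn₅0⟩
  have hcop' : q.Coprime n₅ := Nat.Coprime.coprime_dvd_right ⟨5, by rw [hn, mul_comm]⟩ h
  have h5q : ¬ 5 ∣ q := fun h5' ↦ by
    have := Nat.Coprime.coprime_dvd_right ⟨n₅, hn⟩ (Nat.Coprime.coprime_dvd_left h5' h)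
    norm_num at this
  refine ⟨q * n₅, by rw [hn]; ring, fun h5' ↦ ?_, fun hd χ hχ i j ↦ ?_⟩
  · rcases (Nat.Prime.dvd_mul Nat.prime_five).mp h5' with h' | h'
    · exact h5q h'
    · exact h5 h'
  obtain ⟨χ₁, χ₀, rfl, hp⟩ := exists_eq_prodChar hcop' χ
  obtain ⟨h1, h0⟩ := hp hχ
  have hd5 : n₅ ∣ n := ⟨5, by rw [hn, mul_comm]⟩
  -- evaluation of the product character at the reductions of the `p i`
  have heval : ∀ i, (DirichletCharacter.changeLevel (dvd_mul_right q n₅) χ₁ *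
      DirichletCharacter.changeLevel (dvd_mul_left n₅ q) χ₀) (ZMod.castHom hd (ZMod (q * n₅)) (p i)) =
      χ₁ (ZMod.castHom (dvd_mul_right q n) (ZMod q) (p i)) *
        χ₀ (ZMod.castHom hd5 (ZMod n₅) ((ZMod.unitsMap (dvd_mul_left n q) (p i) : (ZMod n)ˣ) :
          ZMod n)) := by
    intro i
    rw [prodChar_apply, castHom_castHom, castHom_castHom, coe_unitsMap, castHom_castHom]
  rw [heval, heval]
  have key := H hd5 χ₀ h0 i j
  rcases hres i with ⟨hri, hsi⟩ | ⟨hri, hsi, hu⟩ <;> rcases hres j with ⟨hrj, hsj⟩ | ⟨hrj, hsj, hu'⟩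
  · rw [hri, hrj]; rw [hsi, hsj] at key; linear_combination χ₁ (ZMod.castHom (dvd_mul_right q n) (ZMod q) (p 0)) * key
  · rw [hri, hrj, map_mul, hu' χ₁ h1]; rw [hsi, hsj] at key
    linear_combination χ₁ (ZMod.castHom (dvd_mul_right q n) (ZMod q) (p 0)) * key
  · rw [hri, hrj, map_mul, hu χ₁ h1]; rw [hsi, hsj] at key
    linear_combination χ₁ (ZMod.castHom (dvd_mul_right q n) (ZMod q) (p 0)) * key
  · rw [hri, hrj, map_mul, hu χ₁ h1]; rw [hsi, hsj] at key
    linear_combination χ₁ (ZMod.castHom (dvd_mul_right q n) (ZMod q) (p 0)) * key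

end Transport

/-! ### Peels with a two-element kernel: the flipped configuration -/

section Flip

variable {q n : ℕ} [NeZero q] [NeZero n]

/-- If the residues of the four points lie in `{r₀, u r₀}` for a kernel element `u ≠ 1`, the
configuration of avatars with signs flipped on the class `u r₀` is null at level `n`.
[cite: Aoki1983, Cor. 3.4] -/
theorem quad_flip_null (h : q.Coprime n) {d : ℕ} (hd : d ∣ q)
    (hprim : ∀ χ : DirichletCharacter ℂ q, ¬ χ.FactorsThrough d → χ.IsPrimitive)
    (p : Fin 4 → (ZMod (q * n))ˣ) (s : Fin 4 → ℂ)
    (hT : ∀ χ : DirichletCharacter ℂ (q * n), χ.IsPrimitive → ∑ i, s i * χ (p i) = 0)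
    (u : (ZMod q)ˣ) (hu : ZMod.unitsMap hd u = 1) (hu1 : (u : ZMod q) ≠ 1)
    (hres : ∀ i, ZMod.castHom (dvd_mul_right q n) (ZMod q) (p i) =
        ZMod.castHom (dvd_mul_right q n) (ZMod q) (p 0) ∨
      ZMod.castHom (dvd_mul_right q n) (ZMod q) (p i) =
        (u : ZMod q) * ZMod.castHom (dvd_mul_right q n) (ZMod q) (p 0))
    (χ₂ : DirichletCharacter ℂ n) (hχ₂ : χ₂.IsPrimitive) :
    ∑ i, (if ZMod.castHom (dvd_mul_right q n) (ZMod q) (p i) =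
        ZMod.castHom (dvd_mul_right q n) (ZMod q) (p 0) then s i else -s i) *
      χ₂ ((ZMod.unitsMap (dvd_mul_left n q) (p i) : (ZMod n)ˣ) : ZMod n) = 0 := by
  classical
  set r₀ := ZMod.castHom (dvd_mul_right q n) (ZMod q) (p 0) with hr₀
  have hr₀u : IsUnit r₀ := by rw [hr₀]; exact (Units.isUnit (p 0)).map _
  have hne : (u : ZMod q) * r₀ ≠ r₀ := fun he ↦ hu1 (hr₀u.mul_right_cancel (he.trans (one_mul _).symm))
  have key := sum_filter_mul_eq h hd hprim p s hT χ₂ hχ₂ u (ZMod.unitsMap (dvd_mul_right q n) (p 0)) hu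
  rw [coe_unitsMap, ← hr₀] at key
  -- split the total sum according to the residue
  rw [← Finset.sum_filter_add_sum_filter_not univ
    (fun i ↦ ZMod.castHom (dvd_mul_right q n) (ZMod q) (p i) = r₀)]
  have h1 : ∑ i ∈ univ.filter (fun i ↦ ZMod.castHom (dvd_mul_right q n) (ZMod q) (p i) = r₀),
      (if ZMod.castHom (dvd_mul_right q n) (ZMod q) (p i) = r₀ then s i else -s i) *
        χ₂ ((ZMod.unitsMap (dvd_mul_left n q) (p i) : (ZMod n)ˣ) : ZMod n) =
      ∑ i ∈ univ.filter (fun i ↦ ZMod.castHom (dvd_mul_right q n) (ZMod q) (p i) = r₀),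
        s i * χ₂ (ZMod.castHom (dvd_mul_left n q) (ZMod n) (p i)) := by
    refine Finset.sum_congr rfl fun i hi ↦ ?_
    rw [mem_filter] at hi
    rw [if_pos hi.2, coe_unitsMap]
  have h2 : ∑ i ∈ univ.filter (fun i ↦ ¬ ZMod.castHom (dvd_mul_right q n) (ZMod q) (p i) = r₀),
      (if ZMod.castHom (dvd_mul_right q n) (ZMod q) (p i) = r₀ then s i else -s i) *
        χ₂ ((ZMod.unitsMap (dvd_mul_left n q) (p i) : (ZMod n)ˣ) : ZMod n) =
      -∑ i ∈ univ.filter (fun i ↦ ZMod.castHom (dvd_mul_right q n) (ZMod q) (p i) =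
          (u : ZMod q) * r₀), s i * χ₂ (ZMod.castHom (dvd_mul_left n q) (ZMod n) (p i)) := by
    rw [← Finset.sum_neg_distrib]
    have hfilt : univ.filter (fun i ↦ ¬ ZMod.castHom (dvd_mul_right q n) (ZMod q) (p i) = r₀) =
        univ.filter (fun i ↦ ZMod.castHom (dvd_mul_right q n) (ZMod q) (p i) = (u : ZMod q) * r₀) := by
      ext i
      simp only [mem_filter, mem_univ, true_and]
      constructor
      · intro hi
        rcases hres i with h' | h'
        · exact absurd h' hi
        · exact h'
      · intro hi h'
        exact hne (hi.symm.trans h')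
    rw [hfilt]
    refine Finset.sum_congr rfl fun i hi ↦ ?_
    rw [mem_filter] at hi
    rw [if_neg (fun h' ↦ hne (hi.2.symm.trans h')), coe_unitsMap]
    ring
  rw [h1, h2, key]
  ring

end Flip

/-! ### The kernel of order three: the non-free case is contradictory -/

section Coset3

variable {q n : ℕ} [NeZero q] [NeZero n]

/-- **Coset pattern at a kernel of order `3`** (`q = 3^e`, `e ≥ 2`): if some point is not free,
i.e. its whole kernel coset occurs among the residues, then a three-term relation at level `n`
appears, which forces `9 ∣ n`; so for `9 ∤ n` this is contradictory. [cite: Aoki1983, Prop. 8.2] -/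
theorem quad_false_of_coset_three (h : q.Coprime n) {d : ℕ} (hd : d ∣ q)
    (hprim : ∀ χ : DirichletCharacter ℂ q, ¬ χ.FactorsThrough d → χ.IsPrimitive)
    (hval : Odd n ∨ 4 ∣ n) (hn9 : ¬ 9 ∣ n) (p : Fin 4 → (ZMod (q * n))ˣ) (s : Fin 4 → ℂ)
    (hs : ∀ i, s i = 1 ∨ s i = -1)
    (hT : ∀ χ : DirichletCharacter ℂ (q * n), χ.IsPrimitive → ∑ i, s i * χ (p i) = 0)
    (z : (ZMod q)ˣ) (hz : ZMod.unitsMap hd z = 1) (hz1 : (z : ZMod q) ≠ 1) (hz3 : z ^ 3 = 1)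
    (i₀ : Fin 4) (hnf : ∀ u : (ZMod q)ˣ, ZMod.unitsMap hd u = 1 →
      ∃ j, ZMod.castHom (dvd_mul_right q n) (ZMod q) (p j) =
        (u : ZMod q) * ZMod.castHom (dvd_mul_right q n) (ZMod q) (p i₀)) : False := by
  classical
  -- notation
  set r : Fin 4 → ZMod q := fun i ↦ ZMod.castHom (dvd_mul_right q n) (ZMod q) (p i) with hr
  set a : Fin 4 → ZMod n := fun i ↦ ZMod.castHom (dvd_mul_left n q) (ZMod n) (p i) with ha
  have hru : ∀ i, IsUnit (r i) := fun i ↦ (Units.isUnit (p i)).map _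
  have hzz : ZMod.unitsMap hd (z * z) = 1 := by rw [map_mul, hz, one_mul]
  have hz2 : ((z * z : (ZMod q)ˣ) : ZMod q) ≠ 1 := by
    intro h1
    apply hz1
    have h2 : z * z = 1 := Units.ext h1
    have : z = z ^ 3 * (z * z)⁻¹ := by rw [pow_succ, pow_two]; group
    rw [this, hz3, h2, inv_one, one_mul, Units.val_one]
  have hzinv : ((z * z : (ZMod q)ˣ) : ZMod q) * z = 1 := by
    rw [← Units.val_mul, ← pow_two, ← pow_succ, hz3, Units.val_one]
  -- the two other points of the coset
  obtain ⟨j₁, hj₁⟩ := hnf z hz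
  obtain ⟨j₂, hj₂⟩ := hnf (z * z) hzz
  change r j₁ = (z : ZMod q) * r i₀ at hj₁
  change r j₂ = ((z * z : (ZMod q)ˣ) : ZMod q) * r i₀ at hj₂
  -- distinctness of the three residues and indices
  have hne01 : r j₁ ≠ r i₀ := fun he ↦ hz1 ((hru i₀).mul_right_cancel (hj₁.symm.trans he |>.trans (one_mul _).symm))
  have hne02 : r j₂ ≠ r i₀ := fun he ↦ hz2 ((hru i₀).mul_right_cancel (hj₂.symm.trans he |>.trans (one_mul _).symm))
  have hne12 : r j₁ ≠ r j₂ := by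
    intro he
    rw [hj₁, hj₂, Units.val_mul, mul_assoc] at he
    have h2 : r i₀ = (z : ZMod q) * r i₀ := (Units.isUnit z).mul_left_cancel he
    exact hz1 ((hru i₀).mul_right_cancel (h2.symm.trans (one_mul _).symm))
  have hi₀j₁ : i₀ ≠ j₁ := fun he ↦ hne01 (by rw [he])
  have hi₀j₂ : i₀ ≠ j₂ := fun he ↦ hne02 (by rw [he])
  have hj₁j₂ : j₁ ≠ j₂ := fun he ↦ hne12 (by rw [he])
  -- the fourth index
  obtain ⟨m, hm⟩ : ∃ m : Fin 4, m ∉ ({i₀, j₁, j₂} : Finset (Fin 4)) := by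
    have hcard : #({i₀, j₁, j₂} : Finset (Fin 4)) = 3 := by
      rw [Finset.card_insert_of_notMem, Finset.card_pair hj₁j₂]
      simp only [Finset.mem_insert, Finset.mem_singleton, not_or]; exact ⟨hi₀j₁, hi₀j₂⟩
    by_contra hall
    push Not at hall
    have : ({i₀, j₁, j₂} : Finset (Fin 4)) = univ := Finset.eq_univ_of_forall hall
    rw [this, Finset.card_univ, Fintype.card_fin] at hcard
    omega
  simp only [Finset.mem_insert, Finset.mem_singleton, not_or] at hm
  obtain ⟨hmi₀, hmj₁, hmj₂⟩ := hm
  have huniv : ∀ x : Fin 4, x = i₀ ∨ x = j₁ ∨ x = j₂ ∨ x = m := by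
    intro x
    have hcard : ({i₀, j₁, j₂, m} : Finset (Fin 4)) = univ := by
      apply Finset.eq_univ_of_card
      rw [Finset.card_insert_of_notMem, Finset.card_insert_of_notMem, Finset.card_pair (Ne.symm hmj₂)]
      · simp
      · simp only [Finset.mem_insert, Finset.mem_singleton, not_or]; exact ⟨hj₁j₂, Ne.symm hmj₁⟩
      · simp only [Finset.mem_insert, Finset.mem_singleton, not_or]; exact ⟨hi₀j₁, hi₀j₂, Ne.symm hmi₀⟩
    have hx : x ∈ ({i₀, j₁, j₂, m} : Finset (Fin 4)) := by rw [hcard]; exact mem_univ x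
    simpa only [Finset.mem_insert, Finset.mem_singleton] using hx
  -- the two peel equalities: slices at `r i₀`, `z r i₀`, `z² r i₀` agree
  have E1 := fun (χ₂ : DirichletCharacter ℂ n) (hχ₂ : χ₂.IsPrimitive) ↦
    slice_invariant h hd hprim p s hT χ₂ hχ₂ z (ZMod.unitsMap (dvd_mul_right q n) (p i₀)) hz
  have E2 := fun (χ₂ : DirichletCharacter ℂ n) (hχ₂ : χ₂.IsPrimitive) ↦
    slice_invariant h hd hprim p s hT χ₂ hχ₂ (z * z) (ZMod.unitsMap (dvd_mul_right q n) (p i₀)) hzz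
  simp only [coe_unitsMap] at E1 E2
  change ∀ χ₂ : DirichletCharacter ℂ n, χ₂.IsPrimitive →
    (∑ i, (if r i = (z : ZMod q) * r i₀ then s i * χ₂ (a i) else 0)) =
      ∑ i, (if r i = r i₀ then s i * χ₂ (a i) else 0) at E1
  change ∀ χ₂ : DirichletCharacter ℂ n, χ₂.IsPrimitive →
    (∑ i, (if r i = ((z * z : (ZMod q)ˣ) : ZMod q) * r i₀ then s i * χ₂ (a i) else 0)) =
      ∑ i, (if r i = r i₀ then s i * χ₂ (a i) else 0) at E2
  -- units at level `n`
  set b : Fin 4 → (ZMod n)ˣ := fun i ↦ ZMod.unitsMap (dvd_mul_left n q) (p i) with hb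
  have hab : ∀ i, a i = (b i : ZMod n) := fun i ↦ (coe_unitsMap _ _).symm
  have hsneg : ∀ i, -s i = 1 ∨ -s i = -1 := fun i ↦ by
    rcases hs i with h1 | h1 <;> rw [h1] <;> norm_num
  -- case analysis on the residue of `m`
  by_cases hm0 : r m = r i₀
  · -- classes: `{i₀, m}` at `r i₀`, `{j₁}` at `z r i₀`
    refine hn9 (nine_dvd_of_triple_allprim hval (b i₀) (b m) (b j₁) (hs i₀) (hs m) (hsneg j₁)
      fun χ₂ hχ₂ ↦ ?_)
    have e := E1 χ₂ hχ₂
    rw [Finset.sum_eq_single_of_mem j₁ (mem_univ _), if_pos hj₁,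
      Finset.sum_eq_add_of_mem i₀ m (mem_univ _) (mem_univ _) (Ne.symm hmi₀), if_pos rfl,
      if_pos hm0] at e
    · rw [← hab, ← hab, ← hab]; linear_combination -e
    · rintro c - ⟨hc1, hc2⟩
      rcases huniv c with hc' | hc' | hc' | hc' <;> rw [hc'] at hc1 hc2 ⊢
      · exact absurd rfl hc1
      · rw [if_neg hne01]
      · rw [if_neg hne02]
      · exact absurd rfl hc2
    · rintro c - hc
      rcases huniv c with hc' | hc' | hc' | hc' <;> rw [hc'] at hc ⊢
      · rw [if_neg (fun h' ↦ hne01 (hj₁.trans h'.symm))]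
      · exact absurd rfl hc
      · rw [if_neg (fun h' ↦ hne12 (hj₁.trans h'.symm))]
      · rw [if_neg (fun h' ↦ hne01 (hj₁.trans (h'.symm.trans hm0)))]
  by_cases hm1 : r m = (z : ZMod q) * r i₀
  · -- classes: `{i₀}`, `{j₁, m}` at `z r i₀`
    refine hn9 (nine_dvd_of_triple_allprim hval (b j₁) (b m) (b i₀) (hs j₁) (hs m) (hsneg i₀)
      fun χ₂ hχ₂ ↦ ?_)
    have e := E1 χ₂ hχ₂
    rw [Finset.sum_eq_add_of_mem j₁ m (mem_univ _) (mem_univ _) (Ne.symm hmj₁), if_pos hj₁, if_pos hm1,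
      Finset.sum_eq_single_of_mem i₀ (mem_univ _), if_pos rfl] at e
    · rw [← hab, ← hab, ← hab]; linear_combination e
    · rintro c - hc
      rcases huniv c with hc' | hc' | hc' | hc' <;> rw [hc'] at hc ⊢
      · exact absurd rfl hc
      · rw [if_neg hne01]
      · rw [if_neg hne02]
      · rw [if_neg (fun h' ↦ hne01 (hj₁.trans (hm1.symm.trans h')))]
    · rintro c - ⟨hc1, hc2⟩
      rcases huniv c with hc' | hc' | hc' | hc' <;> rw [hc'] at hc1 hc2 ⊢
      · rw [if_neg (fun h' ↦ hne01 (hj₁.trans h'.symm))]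
      · exact absurd rfl hc1
      · rw [if_neg (fun h' ↦ hne12 (hj₁.trans h'.symm))]
      · exact absurd rfl hc2
  by_cases hm2 : r m = ((z * z : (ZMod q)ˣ) : ZMod q) * r i₀
  · -- classes: `{i₀}`, `{j₂, m}` at `z² r i₀`
    refine hn9 (nine_dvd_of_triple_allprim hval (b j₂) (b m) (b i₀) (hs j₂) (hs m) (hsneg i₀)
      fun χ₂ hχ₂ ↦ ?_)
    have e := E2 χ₂ hχ₂
    rw [Finset.sum_eq_add_of_mem j₂ m (mem_univ _) (mem_univ _) (Ne.symm hmj₂), if_pos hj₂, if_pos hm2,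
      Finset.sum_eq_single_of_mem i₀ (mem_univ _), if_pos rfl] at e
    · rw [← hab, ← hab, ← hab]; linear_combination e
    · rintro c - hc
      rcases huniv c with hc' | hc' | hc' | hc' <;> rw [hc'] at hc ⊢
      · exact absurd rfl hc
      · rw [if_neg hne01]
      · rw [if_neg hne02]
      · rw [if_neg hm0]
    · rintro c - ⟨hc1, hc2⟩
      rcases huniv c with hc' | hc' | hc' | hc' <;> rw [hc'] at hc1 hc2 ⊢
      · rw [if_neg (fun h' ↦ hne02 (hj₂.trans h'.symm))]
      · rw [if_neg (fun h' ↦ hne12 (h'.trans hj₂.symm))]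
      · exact absurd rfl hc1
      · exact absurd rfl hc2
  · -- `m` alone outside the coset: free singleton
    refine false_of_singleton_free h hd hprim hval p s (fun i h0 ↦ ?_) hT m ?_ z hz ?_
    · rcases hs i with h1 | h1 <;> rw [h1] at h0 <;> norm_num at h0
    · intro j hj
      change r j = r m at hj
      rcases huniv j with hji | hji | hji | hji <;> rw [hji] at hj ⊢
      · exact absurd hj.symm hm0
      · exact absurd (hj.symm.trans hj₁) hm1
      · exact absurd (hj.symm.trans hj₂) hm2
    · intro j hj
      change r j = (z : ZMod q) * r m at hj
      rcases huniv j with hji | hji | hji | hji <;> rw [hji] at hj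
      · -- `r i₀ = z r m` ⟹ `r m = z² r i₀`
        apply hm2
        rw [hj, Units.val_mul, show (z : ZMod q) * z * ((z : ZMod q) * r m) =
          ((z ^ 3 : (ZMod q)ˣ) : ZMod q) * r m by push_cast; ring, hz3, Units.val_one, one_mul]
      · apply hm0
        rw [hj₁] at hj
        exact ((Units.isUnit z).mul_left_cancel hj).symm
      · apply hm1
        rw [hj₂, Units.val_mul, mul_assoc] at hj
        exact ((Units.isUnit z).mul_left_cancel hj).symm
      · exact hz1 ((hru m).mul_right_cancel (hj.symm.trans (one_mul _).symm))

end Coset3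

/-! ### The level `5`: all residues distinct gives the `5`-terminal conclusion -/

section Five

variable {n : ℕ} [NeZero n]

/-- At `q = 5` with four distinct residues, the slice function is constant on `(ℤ/5)ˣ`: the four
terms `sᵢ χ₂(pᵢ mod n)` agree for every primitive `χ₂` mod `n`. [cite: Aoki1983, Prop. 8.2] -/
theorem quad_five_terminal (h : (5 ^ 1).Coprime n) (p : Fin 4 → (ZMod (5 ^ 1 * n))ˣ)
    (s : Fin 4 → ℂ)
    (hT : ∀ χ : DirichletCharacter ℂ (5 ^ 1 * n), χ.IsPrimitive → ∑ i, s i * χ (p i) = 0)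
    (hdist : ∀ i j, ZMod.castHom (dvd_mul_right (5 ^ 1) n) (ZMod (5 ^ 1)) (p i) =
      ZMod.castHom (dvd_mul_right (5 ^ 1) n) (ZMod (5 ^ 1)) (p j) → i = j) :
    ∃ N₅ : ℕ, 5 ^ 1 * n = 5 * N₅ ∧ ¬ 5 ∣ N₅ ∧ ∀ (hd : N₅ ∣ 5 ^ 1 * n) (χ : DirichletCharacter ℂ N₅),
      χ.IsPrimitive → ∀ i j : Fin 4,
        s i * χ (ZMod.castHom hd (ZMod N₅) (p i)) = s j * χ (ZMod.castHom hd (ZMod N₅) (p j)) := by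
  classical
  haveI : NeZero (5 ^ 1) := ⟨by norm_num⟩
  have hd : 5 ^ (1 - 1) ∣ 5 ^ 1 := pow_dvd_pow 5 (Nat.sub_le 1 1)
  have hprim : ∀ χ : DirichletCharacter ℂ (5 ^ 1), ¬ χ.FactorsThrough (5 ^ (1 - 1)) →
      χ.IsPrimitive := fun χ hχ ↦ isPrimitive_of_not_factorsThrough_primePow Nat.prime_five le_rfl χ hχ
  refine ⟨n, by ring, fun h5 ↦ ?_, fun hd' χ hχ i j ↦ ?_⟩
  · have := Nat.Coprime.coprime_dvd_right h5 h
    norm_num at this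
  -- the slice at `r i` is the single term `s i χ(p i mod n)`
  have hslice : ∀ (χ₂ : DirichletCharacter ℂ n) (i : Fin 4),
      (∑ k, (if ZMod.castHom (dvd_mul_right (5 ^ 1) n) (ZMod (5 ^ 1)) (p k) =
        ZMod.castHom (dvd_mul_right (5 ^ 1) n) (ZMod (5 ^ 1)) (p i) then
        s k * χ₂ (ZMod.castHom (dvd_mul_left n (5 ^ 1)) (ZMod n) (p k)) else 0)) =
      s i * χ₂ (ZMod.castHom (dvd_mul_left n (5 ^ 1)) (ZMod n) (p i)) := by
    intro χ₂ i
    rw [Finset.sum_eq_single_of_mem i (mem_univ _) (fun k _ hk ↦ if_neg (fun he ↦ hk (hdist k i he))),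
      if_pos rfl]
  set v : (ZMod (5 ^ 1))ˣ := ZMod.unitsMap (dvd_mul_right (5 ^ 1) n) (p j) *
    (ZMod.unitsMap (dvd_mul_right (5 ^ 1) n) (p i))⁻¹ with hv
  have key := slice_invariant h hd hprim p s hT χ hχ v (ZMod.unitsMap (dvd_mul_right (5 ^ 1) n) (p i))
    (unitsMap_eq_one_of_eq_one hd (by norm_num) v)
  rw [hv, ← Units.val_mul, inv_mul_cancel_right, coe_unitsMap, coe_unitsMap, hslice, hslice] at key
  exact key.symm

end Five

/-! ### Two kernel cosets at the prime `2` -/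

section TwoCosets

variable {q n : ℕ} [NeZero q] [NeZero n]

/-- An index whose residue coset `{r m, u r m}` contains no other residue is contradictory
(kernel `{1, u}`). [cite: Aoki1983, Prop. 8.2] -/
theorem quad_false_of_alone (h : q.Coprime n) {d : ℕ} (hd : d ∣ q)
    (hprim : ∀ χ : DirichletCharacter ℂ q, ¬ χ.FactorsThrough d → χ.IsPrimitive)
    (hval : Odd n ∨ 4 ∣ n) (p : Fin 4 → (ZMod (q * n))ˣ) (s : Fin 4 → ℂ)
    (hs : ∀ i, s i = 1 ∨ s i = -1)
    (hT : ∀ χ : DirichletCharacter ℂ (q * n), χ.IsPrimitive → ∑ i, s i * χ (p i) = 0)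
    (u : (ZMod q)ˣ) (hu : ZMod.unitsMap hd u = 1) (hu1 : (u : ZMod q) ≠ 1) (m : Fin 4)
    (halone : ∀ j, j ≠ m → ZMod.castHom (dvd_mul_right q n) (ZMod q) (p j) ≠
        ZMod.castHom (dvd_mul_right q n) (ZMod q) (p m) ∧
      ZMod.castHom (dvd_mul_right q n) (ZMod q) (p j) ≠
        (u : ZMod q) * ZMod.castHom (dvd_mul_right q n) (ZMod q) (p m)) : False := by
  have hru : IsUnit (ZMod.castHom (dvd_mul_right q n) (ZMod q) (p m)) := (Units.isUnit (p m)).map _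
  refine false_of_singleton_free h hd hprim hval p s (fun i h0 ↦ ?_) hT m
    (fun j hj ↦ by by_contra hjm; exact (halone j hjm).1 hj) u hu (fun j hj ↦ ?_)
  · rcases hs i with h1 | h1 <;> rw [h1] at h0 <;> norm_num at h0
  · by_cases hjm : j = m
    · rw [hjm] at hj
      exact hu1 (hru.mul_right_cancel (hj.symm.trans (one_mul _).symm))
    · exact (halone j hjm).2 hj

/-- A block `{a, b}` of two indices whose residues lie in one kernel coset `{r a, u r a}` which
contains no other residue is an annihilated pair at level `q n` (kernel `{1, u}`).
[cite: Aoki1983, Prop. 8.2] -/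
theorem quad_pair_of_block (h : q.Coprime n) {d : ℕ} (hd : d ∣ q) (hdq : d ≠ q)
    (hprim : ∀ χ : DirichletCharacter ℂ q, ¬ χ.FactorsThrough d → χ.IsPrimitive)
    (p : Fin 4 → (ZMod (q * n))ˣ) (s : Fin 4 → ℂ)
    (hT : ∀ χ : DirichletCharacter ℂ (q * n), χ.IsPrimitive → ∑ i, s i * χ (p i) = 0)
    (u : (ZMod q)ˣ) (hu : ZMod.unitsMap hd u = 1) (hu1 : (u : ZMod q) ≠ 1)
    (hker : ∀ v : (ZMod q)ˣ, ZMod.unitsMap hd v = 1 → v = 1 ∨ v = u)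
    (a b : Fin 4) (hab : a ≠ b)
    (hb : ZMod.castHom (dvd_mul_right q n) (ZMod q) (p b) =
        ZMod.castHom (dvd_mul_right q n) (ZMod q) (p a) ∨
      ZMod.castHom (dvd_mul_right q n) (ZMod q) (p b) =
        (u : ZMod q) * ZMod.castHom (dvd_mul_right q n) (ZMod q) (p a))
    (hother : ∀ j, j ≠ a → j ≠ b → ZMod.castHom (dvd_mul_right q n) (ZMod q) (p j) ≠
        ZMod.castHom (dvd_mul_right q n) (ZMod q) (p a) ∧
      ZMod.castHom (dvd_mul_right q n) (ZMod q) (p j) ≠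
        (u : ZMod q) * ZMod.castHom (dvd_mul_right q n) (ZMod q) (p a))
    (χ : DirichletCharacter ℂ (q * n)) (hχ : χ.IsPrimitive) : s a * χ (p a) + s b * χ (p b) = 0 := by
  classical
  set ra := ZMod.castHom (dvd_mul_right q n) (ZMod q) (p a) with hra
  have hrau : IsUnit ra := by rw [hra]; exact (Units.isUnit (p a)).map _
  have hne : (u : ZMod q) * ra ≠ ra := fun he ↦ hu1 (hrau.mul_right_cancel (he.trans (one_mul _).symm))
  -- the peel equality at `ra`
  have E := fun (χ₂ : DirichletCharacter ℂ n) (hχ₂ : χ₂.IsPrimitive) ↦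
    slice_invariant h hd hprim p s hT χ₂ hχ₂ u (ZMod.unitsMap (dvd_mul_right q n) (p a)) hu
  simp only [coe_unitsMap] at E
  rcases hb with hb | hb
  · -- same residue: the slice at `ra` is `s a χ₂ + s b χ₂`, the slice at `u ra` is empty
    refine pair_null_of_same_residue h hd hdq (p a) (p b) (s a) (s b) hb.symm (fun χ₂ hχ₂ ↦ ?_) χ hχ
    have e := E χ₂ hχ₂
    rw [Finset.sum_eq_zero, Finset.sum_eq_add_of_mem a b (mem_univ _) (mem_univ _) hab, if_pos rfl,
      if_pos hb] at e
    · exact e.symm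
    · rintro c - ⟨hca, hcb⟩
      rw [if_neg (hother c hca hcb).1]
    · intro c _
      by_cases hca : c = a
      · rw [hca, if_neg (Ne.symm hne)]
      by_cases hcb : c = b
      · rw [hcb, if_neg (fun h' ↦ hne (h'.symm.trans hb))]
      rw [if_neg (hother c hca hcb).2]
  · -- residues `ra` and `u ra`
    refine pair_null_of_coset h hd hdq u hu hker (p a) (p b) (s a) (s b) hb hu1 (fun χ₂ hχ₂ ↦ ?_) χ hχ
    have e := E χ₂ hχ₂
    rw [Finset.sum_eq_single_of_mem b (mem_univ _), if_pos hb,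
      Finset.sum_eq_single_of_mem a (mem_univ _), if_pos rfl] at e
    · exact e.symm
    · intro c _ hca
      by_cases hcb : c = b
      · rw [hcb, if_neg (fun h' ↦ hne (hb.symm.trans h'))]
      rw [if_neg (hother c hca hcb).1]
    · intro c _ hcb
      by_cases hca : c = a
      · rw [hca, if_neg (Ne.symm hne)]
      rw [if_neg (hother c hca hcb).2]

/-- **Two cosets.** If the residues of the four points do not lie in a single kernel coset
(kernel `{1, u}`), the configuration splits into two annihilated pairs at level `q n`.
[cite: Aoki1983, Prop. 8.2] -/
theorem quad_split_of_two_cosets (h : q.Coprime n) {d : ℕ} (hd : d ∣ q) (hdq : d ≠ q)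
    (hprim : ∀ χ : DirichletCharacter ℂ q, ¬ χ.FactorsThrough d → χ.IsPrimitive)
    (hval : Odd n ∨ 4 ∣ n) (p : Fin 4 → (ZMod (q * n))ˣ) (s : Fin 4 → ℂ)
    (hs : ∀ i, s i = 1 ∨ s i = -1)
    (hT : ∀ χ : DirichletCharacter ℂ (q * n), χ.IsPrimitive → ∑ i, s i * χ (p i) = 0)
    (u : (ZMod q)ˣ) (hu : ZMod.unitsMap hd u = 1) (hu1 : (u : ZMod q) ≠ 1)
    (hker : ∀ v : (ZMod q)ˣ, ZMod.unitsMap hd v = 1 → v = 1 ∨ v = u)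
    (htwo : ∃ i, ZMod.castHom (dvd_mul_right q n) (ZMod q) (p i) ≠
        ZMod.castHom (dvd_mul_right q n) (ZMod q) (p 0) ∧
      ZMod.castHom (dvd_mul_right q n) (ZMod q) (p i) ≠
        (u : ZMod q) * ZMod.castHom (dvd_mul_right q n) (ZMod q) (p 0)) :
    ∃ i j k l : Fin 4, i ≠ j ∧ i ≠ k ∧ i ≠ l ∧ j ≠ k ∧ j ≠ l ∧ k ≠ l ∧
      (∀ χ : DirichletCharacter ℂ (q * n), χ.IsPrimitive → s i * χ (p i) + s j * χ (p j) = 0) ∧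
      (∀ χ : DirichletCharacter ℂ (q * n), χ.IsPrimitive → s k * χ (p k) + s l * χ (p l) = 0) := by
  classical
  set r : Fin 4 → ZMod q := fun i ↦ ZMod.castHom (dvd_mul_right q n) (ZMod q) (p i) with hr
  have hru : ∀ i, IsUnit (r i) := fun i ↦ (Units.isUnit (p i)).map _
  have hu2 : (u : ZMod q) * (u : ZMod q) = 1 := by
    rcases hker (u * u) (by rw [map_mul, hu, one_mul]) with h1 | h1
    · rw [← Units.val_mul, h1, Units.val_one]
    · exfalso; apply hu1
      have := mul_left_cancel (a := u) (h1.trans (mul_one u).symm)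
      rw [this, Units.val_one]
  -- membership in a coset is symmetric
  have hsym : ∀ i j, (r j = r i ∨ r j = (u : ZMod q) * r i) → (r i = r j ∨ r i = (u : ZMod q) * r j) := by
    rintro i j (hj | hj)
    · exact Or.inl hj.symm
    · right; rw [hj, ← mul_assoc, hu2, one_mul]
  have htrans : ∀ i j k, (r j = r i ∨ r j = (u : ZMod q) * r i) → (r k = r i ∨ r k = (u : ZMod q) * r i) →
      (r k = r j ∨ r k = (u : ZMod q) * r j) := by
    rintro i j k (hj | hj) (hk | hk)
    · exact Or.inl (hk.trans hj.symm)
    · right; rw [hk, hj]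
    · right; rw [hk, hj, ← mul_assoc, hu2, one_mul]
    · left; rw [hk, hj]
  have alone := fun (m : Fin 4) ↦ quad_false_of_alone h hd hprim hval p s hs hT u hu hu1 m
  have block := fun (a b : Fin 4) ↦ quad_pair_of_block h hd hdq hprim p s hT u hu hu1 hker a b
  -- `B i j`: `j` lies in the kernel coset of `i`
  have notB : ∀ i j, ¬ (r j = r i ∨ r j = (u : ZMod q) * r i) → ¬ (r i = r j ∨ r i = (u : ZMod q) * r j) :=
    fun i j hn hb ↦ hn (hsym j i hb)
  -- from `B 0 j` and `¬ B 0 m`: `¬ B m j`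
  have sep : ∀ j m, (r j = r 0 ∨ r j = (u : ZMod q) * r 0) → ¬ (r m = r 0 ∨ r m = (u : ZMod q) * r 0) →
      ¬ (r j = r m ∨ r j = (u : ZMod q) * r m) := by
    intro j m hj hm hjm
    exact hm (htrans j 0 m (hsym 0 j hj) (hsym m j hjm))
  by_cases h1 : r 1 = r 0 ∨ r 1 = (u : ZMod q) * r 0 <;>
    by_cases h2 : r 2 = r 0 ∨ r 2 = (u : ZMod q) * r 0 <;>
    by_cases h3 : r 3 = r 0 ∨ r 3 = (u : ZMod q) * r 0
  · exfalso
    obtain ⟨i, hi⟩ := htwo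
    have hi' : ¬ (r i = r 0 ∨ r i = (u : ZMod q) * r 0) := not_or.mpr hi
    fin_cases i
    · exact hi' (Or.inl rfl)
    · exact hi' h1
    · exact hi' h2
    · exact hi' h3
  · exfalso; refine alone 3 fun j hj ↦ not_or.mp ?_
    fin_cases j
    · exact notB 0 3 h3
    · exact sep 1 3 h1 h3
    · exact sep 2 3 h2 h3
    · exact absurd rfl hj
  · exfalso; refine alone 2 fun j hj ↦ not_or.mp ?_
    fin_cases j
    · exact notB 0 2 h2
    · exact sep 1 2 h1 h2
    · exact absurd rfl hj
    · exact sep 3 2 h3 h2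
  · -- blocks `{0, 1}` and `{2, 3}` or `2` alone
    by_cases h23 : r 3 = r 2 ∨ r 3 = (u : ZMod q) * r 2
    · refine ⟨0, 1, 2, 3, by decide, by decide, by decide, by decide, by decide, by decide,
        block 0 1 (by decide) h1 (fun x hx0 hx1 ↦ not_or.mp ?_),
        block 2 3 (by decide) h23 (fun x hx2 hx3 ↦ not_or.mp ?_)⟩
      · fin_cases x
        · exact absurd rfl hx0
        · exact absurd rfl hx1
        · exact h2
        · exact h3
      · fin_cases x
        · exact notB 0 2 h2
        · exact sep 1 2 h1 h2
        · exact absurd rfl hx2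
        · exact absurd rfl hx3
    · exfalso; refine alone 2 fun j hj ↦ not_or.mp ?_
      fin_cases j
      · exact notB 0 2 h2
      · exact sep 1 2 h1 h2
      · exact absurd rfl hj
      · exact h23
  · exfalso; refine alone 1 fun j hj ↦ not_or.mp ?_
    fin_cases j
    · exact notB 0 1 h1
    · exact absurd rfl hj
    · exact sep 2 1 h2 h1
    · exact sep 3 1 h3 h1
  · -- blocks `{0, 2}` and `{1, 3}` or `1` alone
    by_cases h13 : r 3 = r 1 ∨ r 3 = (u : ZMod q) * r 1
    · refine ⟨0, 2, 1, 3, by decide, by decide, by decide, by decide, by decide, by decide,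
        block 0 2 (by decide) h2 (fun x hx0 hx2 ↦ not_or.mp ?_),
        block 1 3 (by decide) h13 (fun x hx1 hx3 ↦ not_or.mp ?_)⟩
      · fin_cases x
        · exact absurd rfl hx0
        · exact h1
        · exact absurd rfl hx2
        · exact h3
      · fin_cases x
        · exact notB 0 1 h1
        · exact absurd rfl hx1
        · exact sep 2 1 h2 h1
        · exact absurd rfl hx3
    · exfalso; refine alone 1 fun j hj ↦ not_or.mp ?_
      fin_cases j
      · exact notB 0 1 h1
      · exact absurd rfl hj
      · exact sep 2 1 h2 h1
      · exact h13
  · -- blocks `{0, 3}` and `{1, 2}` or `1` alone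
    by_cases h12 : r 2 = r 1 ∨ r 2 = (u : ZMod q) * r 1
    · refine ⟨0, 3, 1, 2, by decide, by decide, by decide, by decide, by decide, by decide,
        block 0 3 (by decide) h3 (fun x hx0 hx3 ↦ not_or.mp ?_),
        block 1 2 (by decide) h12 (fun x hx1 hx2 ↦ not_or.mp ?_)⟩
      · fin_cases x
        · exact absurd rfl hx0
        · exact h1
        · exact h2
        · exact absurd rfl hx3
      · fin_cases x
        · exact notB 0 1 h1
        · exact absurd rfl hx1
        · exact absurd rfl hx2
        · exact sep 3 1 h3 h1
    · exfalso; refine alone 1 fun j hj ↦ not_or.mp ?_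
      fin_cases j
      · exact notB 0 1 h1
      · exact absurd rfl hj
      · exact h12
      · exact sep 3 1 h3 h1
  · exfalso; refine alone 0 fun j hj ↦ not_or.mp ?_
    fin_cases j
    · exact absurd rfl hj
    · exact h1
    · exact h2
    · exact h3

end TwoCosets

/-! ### Helpers for the main recursion -/

section Helpers

variable {q n : ℕ} [NeZero q] [NeZero n]

omit [NeZero n] in
/-- **Counting gives free residues.** If the kernel has more elements than there are residues,
every residue class is free. [folklore] -/
theorem exists_free_of_card_image_lt {d : ℕ} (hd : d ∣ q) {k : ℕ} (r : Fin k → ZMod q)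
    (hr : ∀ i, IsUnit (r i))
    (hcard : #(univ.image r) < #(univ.filter fun u : (ZMod q)ˣ ↦ ZMod.unitsMap hd u = 1)) (i : Fin k) :
    ∃ u : (ZMod q)ˣ, ZMod.unitsMap hd u = 1 ∧ ∀ j, r j ≠ (u : ZMod q) * r i := by
  classical
  by_contra hcon
  push Not at hcon
  -- `u ↦ u * r i` maps the kernel injectively into the image of `r`
  have hmap : ∀ u ∈ univ.filter (fun u : (ZMod q)ˣ ↦ ZMod.unitsMap hd u = 1),
      (u : ZMod q) * r i ∈ univ.image r := by
    intro u hu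
    rw [mem_filter] at hu
    obtain ⟨j, hj⟩ := hcon u hu.2
    exact mem_image.mpr ⟨j, mem_univ _, hj⟩
  have hinj : Set.InjOn (fun u : (ZMod q)ˣ ↦ (u : ZMod q) * r i)
      (univ.filter (fun u : (ZMod q)ˣ ↦ ZMod.unitsMap hd u = 1) : Set (ZMod q)ˣ) := by
    intro u _ v _ huv
    exact Units.ext ((hr i).mul_right_cancel huv)
  have := Finset.card_le_card_of_injOn _ hmap hinj
  omega

omit [NeZero n] in
/-- Elements of the kernel satisfy `u ^ #ker = 1`. [folklore] -/
theorem pow_card_ker_eq_one {d : ℕ} (hd : d ∣ q) (u : (ZMod q)ˣ) (hu : ZMod.unitsMap hd u = 1) :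
    u ^ #(univ.filter fun v : (ZMod q)ˣ ↦ ZMod.unitsMap hd v = 1) = 1 := by
  classical
  set K := (ZMod.unitsMap hd).ker with hK
  have huK : u ∈ K := by rw [hK, MonoidHom.mem_ker]; exact hu
  have hcard : #(univ.filter fun v : (ZMod q)ˣ ↦ ZMod.unitsMap hd v = 1) = Nat.card K := by
    rw [Nat.card_eq_fintype_card, Fintype.card_subtype]
    congr 1
    ext v
    simp [hK, MonoidHom.mem_ker]
  have h2 : ((⟨u, huK⟩ : K) : (ZMod q)ˣ) ^ Nat.card K = 1 := by
    have h3 := congrArg Subtype.val (pow_card_eq_one' (G := K) (x := ⟨u, huK⟩))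
    rwa [Subgroup.coe_pow, Subgroup.coe_one] at h3
  rw [hcard]
  exact h2

/-- Finishing a concentrated peel: the conclusion for the avatars at level `n` transports to
level `q n`. [cite: Aoki1983, Prop. 8.2] -/
theorem quad_conc_finish (h : q.Coprime n) {d : ℕ} (hd : d ∣ q) (hdq : d ≠ q)
    (p : Fin 4 → (ZMod (q * n))ˣ) (s : Fin 4 → ℂ)
    (hconc : ∀ i, ZMod.castHom (dvd_mul_right q n) (ZMod q) (p i) =
      ZMod.castHom (dvd_mul_right q n) (ZMod q) (p 0))
    (hIH : (∃ i j k l : Fin 4, i ≠ j ∧ i ≠ k ∧ i ≠ l ∧ j ≠ k ∧ j ≠ l ∧ k ≠ l ∧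
        (∀ χ₂ : DirichletCharacter ℂ n, χ₂.IsPrimitive →
          s i * χ₂ ((ZMod.unitsMap (dvd_mul_left n q) (p i) : (ZMod n)ˣ) : ZMod n) +
          s j * χ₂ ((ZMod.unitsMap (dvd_mul_left n q) (p j) : (ZMod n)ˣ) : ZMod n) = 0) ∧
        (∀ χ₂ : DirichletCharacter ℂ n, χ₂.IsPrimitive →
          s k * χ₂ ((ZMod.unitsMap (dvd_mul_left n q) (p k) : (ZMod n)ˣ) : ZMod n) +
          s l * χ₂ ((ZMod.unitsMap (dvd_mul_left n q) (p l) : (ZMod n)ˣ) : ZMod n) = 0)) ∨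
      (∃ n₅ : ℕ, n = 5 * n₅ ∧ ¬ 5 ∣ n₅ ∧ ∀ (hd5 : n₅ ∣ n) (χ₀ : DirichletCharacter ℂ n₅),
        χ₀.IsPrimitive → ∀ i j : Fin 4,
          s i * χ₀ (ZMod.castHom hd5 (ZMod n₅) ((ZMod.unitsMap (dvd_mul_left n q) (p i) :
            (ZMod n)ˣ) : ZMod n)) =
          s j * χ₀ (ZMod.castHom hd5 (ZMod n₅) ((ZMod.unitsMap (dvd_mul_left n q) (p j) :
            (ZMod n)ˣ) : ZMod n)))) :
    (∃ i j k l : Fin 4, i ≠ j ∧ i ≠ k ∧ i ≠ l ∧ j ≠ k ∧ j ≠ l ∧ k ≠ l ∧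
      (∀ χ : DirichletCharacter ℂ (q * n), χ.IsPrimitive → s i * χ (p i) + s j * χ (p j) = 0) ∧
      (∀ χ : DirichletCharacter ℂ (q * n), χ.IsPrimitive → s k * χ (p k) + s l * χ (p l) = 0)) ∨
    (∃ N₅ : ℕ, q * n = 5 * N₅ ∧ ¬ 5 ∣ N₅ ∧ ∀ (hd' : N₅ ∣ q * n) (χ : DirichletCharacter ℂ N₅),
      χ.IsPrimitive → ∀ i j : Fin 4,
        s i * χ (ZMod.castHom hd' (ZMod N₅) (p i)) = s j * χ (ZMod.castHom hd' (ZMod N₅) (p j))) := by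
  rcases hIH with ⟨i, j, k, l, h1, h2, h3, h4, h5, h6, hp1, hp2⟩ | hfive
  · left
    exact ⟨i, j, k, l, h1, h2, h3, h4, h5, h6, quad_pair_lift_conc h hd hdq p s hconc i j hp1,
      quad_pair_lift_conc h hd hdq p s hconc k l hp2⟩
  · right
    exact quad_five_lift h 1 p s s (fun i ↦ Or.inl ⟨hconc i, rfl⟩) hfive

/-- Finishing a peel with a flip set (kernel `{1, u}`, `χ₁(u) = -1` for primitive `χ₁`).
[cite: Aoki1983, Prop. 8.2] -/
theorem quad_flip_finish (h : q.Coprime n) {d : ℕ} (hd : d ∣ q) (hdq : d ≠ q)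
    (u : (ZMod q)ˣ) (hu : ZMod.unitsMap hd u = 1) (hu1 : (u : ZMod q) ≠ 1)
    (hker : ∀ v : (ZMod q)ˣ, ZMod.unitsMap hd v = 1 → v = 1 ∨ v = u)
    (hχu : ∀ χ₁ : DirichletCharacter ℂ q, χ₁.IsPrimitive → χ₁ u = -1)
    (p : Fin 4 → (ZMod (q * n))ˣ) (s : Fin 4 → ℂ)
    (hall : ∀ i, ZMod.castHom (dvd_mul_right q n) (ZMod q) (p i) =
        ZMod.castHom (dvd_mul_right q n) (ZMod q) (p 0) ∨
      ZMod.castHom (dvd_mul_right q n) (ZMod q) (p i) =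
        (u : ZMod q) * ZMod.castHom (dvd_mul_right q n) (ZMod q) (p 0))
    (s' : Fin 4 → ℂ)
    (hs' : ∀ i, s' i = if ZMod.castHom (dvd_mul_right q n) (ZMod q) (p i) =
        ZMod.castHom (dvd_mul_right q n) (ZMod q) (p 0) then s i else -s i)
    (hIH : (∃ i j k l : Fin 4, i ≠ j ∧ i ≠ k ∧ i ≠ l ∧ j ≠ k ∧ j ≠ l ∧ k ≠ l ∧
        (∀ χ₂ : DirichletCharacter ℂ n, χ₂.IsPrimitive →
          s' i * χ₂ ((ZMod.unitsMap (dvd_mul_left n q) (p i) : (ZMod n)ˣ) : ZMod n) +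
          s' j * χ₂ ((ZMod.unitsMap (dvd_mul_left n q) (p j) : (ZMod n)ˣ) : ZMod n) = 0) ∧
        (∀ χ₂ : DirichletCharacter ℂ n, χ₂.IsPrimitive →
          s' k * χ₂ ((ZMod.unitsMap (dvd_mul_left n q) (p k) : (ZMod n)ˣ) : ZMod n) +
          s' l * χ₂ ((ZMod.unitsMap (dvd_mul_left n q) (p l) : (ZMod n)ˣ) : ZMod n) = 0)) ∨
      (∃ n₅ : ℕ, n = 5 * n₅ ∧ ¬ 5 ∣ n₅ ∧ ∀ (hd5 : n₅ ∣ n) (χ₀ : DirichletCharacter ℂ n₅),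
        χ₀.IsPrimitive → ∀ i j : Fin 4,
          s' i * χ₀ (ZMod.castHom hd5 (ZMod n₅) ((ZMod.unitsMap (dvd_mul_left n q) (p i) :
            (ZMod n)ˣ) : ZMod n)) =
          s' j * χ₀ (ZMod.castHom hd5 (ZMod n₅) ((ZMod.unitsMap (dvd_mul_left n q) (p j) :
            (ZMod n)ˣ) : ZMod n)))) :
    (∃ i j k l : Fin 4, i ≠ j ∧ i ≠ k ∧ i ≠ l ∧ j ≠ k ∧ j ≠ l ∧ k ≠ l ∧
      (∀ χ : DirichletCharacter ℂ (q * n), χ.IsPrimitive → s i * χ (p i) + s j * χ (p j) = 0) ∧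
      (∀ χ : DirichletCharacter ℂ (q * n), χ.IsPrimitive → s k * χ (p k) + s l * χ (p l) = 0)) ∨
    (∃ N₅ : ℕ, q * n = 5 * N₅ ∧ ¬ 5 ∣ N₅ ∧ ∀ (hd' : N₅ ∣ q * n) (χ : DirichletCharacter ℂ N₅),
      χ.IsPrimitive → ∀ i j : Fin 4,
        s i * χ (ZMod.castHom hd' (ZMod N₅) (p i)) = s j * χ (ZMod.castHom hd' (ZMod N₅) (p j))) := by
  have hr0u : IsUnit (ZMod.castHom (dvd_mul_right q n) (ZMod q) (p 0)) := (Units.isUnit (p 0)).map _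
  have hne : (u : ZMod q) * ZMod.castHom (dvd_mul_right q n) (ZMod q) (p 0) ≠
      ZMod.castHom (dvd_mul_right q n) (ZMod q) (p 0) :=
    fun he ↦ hu1 (hr0u.mul_right_cancel (he.trans (one_mul _).symm))
  -- the flip data in the form used by the transport lemmas
  have hres : ∀ i, (ZMod.castHom (dvd_mul_right q n) (ZMod q) (p i) =
        ZMod.castHom (dvd_mul_right q n) (ZMod q) (p 0) ∧ s' i = s i) ∨
      (ZMod.castHom (dvd_mul_right q n) (ZMod q) (p i) =
        (u : ZMod q) * ZMod.castHom (dvd_mul_right q n) (ZMod q) (p 0) ∧ s' i = -s i) := by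
    intro i
    rcases hall i with hi | hi
    · exact Or.inl ⟨hi, by rw [hs' i, if_pos hi]⟩
    · exact Or.inr ⟨hi, by rw [hs' i, if_neg (fun h' ↦ hne (hi.symm.trans h'))]⟩
  rcases hIH with ⟨i, j, k, l, h1, h2, h3, h4, h5, h6, hp1, hp2⟩ | hfive
  · left
    exact ⟨i, j, k, l, h1, h2, h3, h4, h5, h6,
      quad_pair_lift_flip h hd hdq u hu hu1 hker p s s' hres i j hp1,
      quad_pair_lift_flip h hd hdq u hu hu1 hker p s s' hres k l hp2⟩
  · right
    exact quad_five_lift h u p s s'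
      (fun i ↦ (hres i).imp id (fun h' ↦ ⟨h'.1, h'.2, hχu⟩)) hfive

/-- The base of the recursion: level `1`, where the only character is trivial and the four signs
sum to zero. [folklore] -/
theorem quad_level_one (p : Fin 4 → (ZMod 1)ˣ) (s : Fin 4 → ℂ) (hs : ∀ i, s i = 1 ∨ s i = -1)
    (hT : ∀ χ : DirichletCharacter ℂ 1, χ.IsPrimitive → ∑ i, s i * χ (p i) = 0) :
    ∃ i j k l : Fin 4, i ≠ j ∧ i ≠ k ∧ i ≠ l ∧ j ≠ k ∧ j ≠ l ∧ k ≠ l ∧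
      (∀ χ : DirichletCharacter ℂ 1, χ.IsPrimitive → s i * χ (p i) + s j * χ (p j) = 0) ∧
      (∀ χ : DirichletCharacter ℂ 1, χ.IsPrimitive → s k * χ (p k) + s l * χ (p l) = 0) := by
  have hχ1 : ∀ (χ : DirichletCharacter ℂ 1) (x : (ZMod 1)ˣ), χ x = 1 := fun χ x ↦ by
    rw [χ.level_one, MulChar.one_apply_coe]
  have h1p : (1 : DirichletCharacter ℂ 1).IsPrimitive := by
    rw [DirichletCharacter.isPrimitive_def, DirichletCharacter.conductor_one]
  have hsum := hT 1 h1p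
  simp only [Fin.sum_univ_four, hχ1, mul_one] at hsum
  have pair : ∀ i j : Fin 4, s i + s j = 0 →
      ∀ χ : DirichletCharacter ℂ 1, χ.IsPrimitive → s i * χ (p i) + s j * χ (p j) = 0 := by
    intro i j hij χ _
    rw [hχ1, hχ1, mul_one, mul_one, hij]
  by_cases h01 : s 0 + s 1 = 0
  · exact ⟨0, 1, 2, 3, by decide, by decide, by decide, by decide, by decide, by decide,
      pair 0 1 h01, pair 2 3 (by linear_combination hsum - h01)⟩
  by_cases h02 : s 0 + s 2 = 0
  · exact ⟨0, 2, 1, 3, by decide, by decide, by decide, by decide, by decide, by decide,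
      pair 0 2 h02, pair 1 3 (by linear_combination hsum - h02)⟩
  by_cases h03 : s 0 + s 3 = 0
  · exact ⟨0, 3, 1, 2, by decide, by decide, by decide, by decide, by decide, by decide,
      pair 0 3 h03, pair 1 2 (by linear_combination hsum - h03)⟩
  exfalso
  have key : s 0 + s 1 ≠ 0 ∧ s 0 + s 2 ≠ 0 ∧ s 0 + s 3 ≠ 0 ∧ s 0 + s 1 + s 2 + s 3 = 0 :=
    ⟨h01, h02, h03, hsum⟩
  rcases hs 0 with h0 | h0 <;> rcases hs 1 with h1 | h1 <;> rcases hs 2 with h2 | h2 <;>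
    rcases hs 3 with h3 | h3 <;> simp only [h0, h1, h2, h3] at key <;> norm_num at key

end Helpers

/-! ### The main recursion `R(n)` -/

section Main

/-- **Four-term configurations annihilated by all primitive characters** (the recursion `R(n)` of
the peeling calculus): four units `pᵢ` with signs `sᵢ = ±1` and `∑ sᵢ χ(pᵢ) = 0` for every
primitive character `χ` mod `N` (`N` odd or `4 ∣ N`) either SPLIT into two annihilated pairs, or
`5 ∥ N` and the four terms `sᵢ χ₀(pᵢ)` agree for every primitive `χ₀` mod `N/5`.
[cite: Aoki1983, Prop. 8.2] -/
theorem quad_allprim (N : ℕ) (hN0 : N ≠ 0) (hval : Odd N ∨ 4 ∣ N) :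
    ∀ (p : Fin 4 → (ZMod N)ˣ) (s : Fin 4 → ℂ), (∀ i, s i = 1 ∨ s i = -1) →
    (∀ χ : DirichletCharacter ℂ N, χ.IsPrimitive → ∑ i, s i * χ (p i) = 0) →
    (∃ i j k l : Fin 4, i ≠ j ∧ i ≠ k ∧ i ≠ l ∧ j ≠ k ∧ j ≠ l ∧ k ≠ l ∧
      (∀ χ : DirichletCharacter ℂ N, χ.IsPrimitive → s i * χ (p i) + s j * χ (p j) = 0) ∧
      (∀ χ : DirichletCharacter ℂ N, χ.IsPrimitive → s k * χ (p k) + s l * χ (p l) = 0)) ∨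
    (∃ N₅ : ℕ, N = 5 * N₅ ∧ ¬ 5 ∣ N₅ ∧ ∀ (hd : N₅ ∣ N) (χ : DirichletCharacter ℂ N₅),
      χ.IsPrimitive → ∀ i j : Fin 4,
        s i * χ (ZMod.castHom hd (ZMod N₅) (p i)) = s j * χ (ZMod.castHom hd (ZMod N₅) (p j))) := by
  classical
  induction N using Nat.strong_induction_on with
  | _ N ih =>
  intro p s hs hT
  haveI : NeZero N := ⟨hN0⟩
  -- level 1
  by_cases hN1 : N = 1
  · subst hN1
    exact Or.inl (quad_level_one p s hs hT)
  /- choose the prime to peel: `2` if `N` is even; `3` if `3 ∣ N`; `5` if `5 ∥ N`; otherwise any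
  prime (whose kernel then has at least five elements) -/
  obtain ⟨pr, hp, hpn, hchoice⟩ : ∃ pr, pr.Prime ∧ pr ∣ N ∧
      (pr = 2 ∨ (pr = 3 ∧ ¬ 2 ∣ N) ∨ (pr = 5 ∧ ¬ 25 ∣ N ∧ ¬ 2 ∣ N ∧ ¬ 3 ∣ N) ∨
        (pr ≠ 2 ∧ pr ≠ 3 ∧ (pr = 5 → 25 ∣ N) ∧ ¬ 2 ∣ N ∧ ¬ 3 ∣ N)) := by
    by_cases h2 : 2 ∣ N
    · exact ⟨2, Nat.prime_two, h2, Or.inl rfl⟩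
    by_cases h3 : 3 ∣ N
    · exact ⟨3, Nat.prime_three, h3, Or.inr (Or.inl ⟨rfl, h2⟩)⟩
    by_cases h5 : 5 ∣ N ∧ ¬ 25 ∣ N
    · exact ⟨5, Nat.prime_five, h5.1, Or.inr (Or.inr (Or.inl ⟨rfl, h5.2, h2, h3⟩))⟩
    · refine ⟨N.minFac, Nat.minFac_prime hN1, Nat.minFac_dvd N, Or.inr (Or.inr (Or.inr ⟨?_, ?_, ?_, h2, h3⟩))⟩
      · intro h; exact h2 (h ▸ Nat.minFac_dvd N)
      · intro h; exact h3 (h ▸ Nat.minFac_dvd N)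
      · intro h
        by_contra h25
        exact h5 ⟨h ▸ Nat.minFac_dvd N, h25⟩
  -- decompose `N = pr^e * m`
  obtain ⟨e, he⟩ : ∃ e, N.factorization pr = e := ⟨_, rfl⟩
  have he1 : 1 ≤ e := he ▸ hp.factorization_pos_of_dvd hN0 hpn
  have hcop0 : Nat.Coprime pr (N / pr ^ e) := he ▸ Nat.coprime_ordCompl hp hN0
  have hpow2 : ∀ r : ℕ, r.Prime → pr = r → r ^ 2 ∣ N → 2 ≤ e := fun r hr hpr h2 ↦ by
    subst hpr
    exact he ▸ (hp.pow_dvd_iff_le_factorization hN0).mp h2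
  obtain ⟨m, rfl⟩ : ∃ m, N = pr ^ e * m :=
    ⟨N / pr ^ e, by rw [← he]; exact (Nat.ordProj_mul_ordCompl_eq_self N pr).symm⟩
  have hpe0 : pr ^ e ≠ 0 := pow_ne_zero e hp.ne_zero
  have hm0 : m ≠ 0 := fun h0 ↦ hN0 (by rw [h0, mul_zero])
  haveI : NeZero m := ⟨hm0⟩
  haveI : NeZero (pr ^ e) := ⟨hpe0⟩
  have hdiv : pr ^ e * m / pr ^ e = m := Nat.mul_div_cancel_left m (Nat.pos_of_ne_zero hpe0)
  rw [hdiv] at hcop0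
  have hcop : (pr ^ e).Coprime m := Nat.Coprime.pow_left e hcop0
  have hq1 : 1 < pr ^ e := lt_of_lt_of_le hp.one_lt (Nat.le_self_pow (by omega) pr)
  have hlt : m < pr ^ e * m := (Nat.lt_mul_iff_one_lt_left (Nat.pos_of_ne_zero hm0)).mpr hq1
  have hpm : ¬ pr ∣ m := fun hd ↦ by
    have := Nat.Coprime.coprime_dvd_right hd hcop0
    rw [Nat.coprime_self] at this
    exact hp.one_lt.ne' this
  have hmval : Odd m ∨ 4 ∣ m := by
    by_cases hp2 : pr = 2
    · subst hp2
      left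
      exact Nat.odd_iff.mpr (by omega)
    · rcases hval with ho | h4
      · exact Or.inl (Nat.Odd.of_mul_right ho)
      · right
        have hc' : Nat.Coprime (2 ^ 2) (pr ^ e) :=
          Nat.Coprime.pow 2 e ((Nat.coprime_primes Nat.prime_two hp).mpr (Ne.symm hp2))
        exact (show Nat.Coprime 4 (pr ^ e) by simpa using hc').dvd_of_dvd_mul_left h4
  have ih' := ih m hlt hm0 hmval
  -- common data
  have hd : pr ^ (e - 1) ∣ pr ^ e := pow_dvd_pow pr (Nat.sub_le e 1)
  have hdq : pr ^ (e - 1) ≠ pr ^ e := fun h ↦ by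
    have := Nat.pow_right_injective hp.two_le h; omega
  have hprim : ∀ χ : DirichletCharacter ℂ (pr ^ e), ¬ χ.FactorsThrough (pr ^ (e - 1)) →
      χ.IsPrimitive := fun χ hχ ↦ isPrimitive_of_not_factorsThrough_primePow hp he1 χ hχ
  -- the residues
  set r : Fin 4 → ZMod (pr ^ e) := fun i ↦ ZMod.castHom (dvd_mul_right (pr ^ e) m) (ZMod (pr ^ e)) (p i) with hr
  have hru : ∀ i, IsUnit (r i) := fun i ↦ (Units.isUnit (p i)).map _
  have hrimage : #(univ.image r) ≤ 4 := le_trans Finset.card_image_le (by simp)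
  -- the free branch, packaged
  have freeCase : (∀ i, ∃ u : (ZMod (pr ^ e))ˣ, ZMod.unitsMap hd u = 1 ∧
      ∀ j, r j ≠ (u : ZMod (pr ^ e)) * r i) →
      (∃ i j k l : Fin 4, i ≠ j ∧ i ≠ k ∧ i ≠ l ∧ j ≠ k ∧ j ≠ l ∧ k ≠ l ∧
        (∀ χ : DirichletCharacter ℂ (pr ^ e * m), χ.IsPrimitive → s i * χ (p i) + s j * χ (p j) = 0) ∧
        (∀ χ : DirichletCharacter ℂ (pr ^ e * m), χ.IsPrimitive → s k * χ (p k) + s l * χ (p l) = 0)) ∨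
      (∃ N₅ : ℕ, pr ^ e * m = 5 * N₅ ∧ ¬ 5 ∣ N₅ ∧ ∀ (hd' : N₅ ∣ pr ^ e * m)
        (χ : DirichletCharacter ℂ N₅), χ.IsPrimitive → ∀ i j : Fin 4,
          s i * χ (ZMod.castHom hd' (ZMod N₅) (p i)) = s j * χ (ZMod.castHom hd' (ZMod N₅) (p j))) := by
    intro hfree
    rcases quad_step_free hcop hd hdq hprim hmval p s hs hT hfree with ⟨hconc, hnull⟩ | hsplit
    · exact quad_conc_finish hcop hd hdq p s hconc (ih' _ s hs hnull)
    · exact Or.inl hsplit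
  rcases hchoice with hp2 | ⟨hp3, h2N⟩ | ⟨hp5, h25, h2N, h3N⟩ | ⟨hp2, hp3, hp25, h2N, h3N⟩
  · /- `pr = 2`: kernel `{1, z}` -/
    subst hp2
    have h4' : 4 ∣ 2 ^ e * m := by
      rcases hval with ho | h4
      · exfalso
        exact (Nat.not_even_iff_odd.mpr ho) (even_iff_two_dvd.mpr
          (dvd_trans (dvd_pow_self 2 (by omega)) (dvd_mul_right _ _)))
      · exact h4
    have he2 : 2 ≤ e := hpow2 2 Nat.prime_two rfl (by simpa using h4')
    have hmodd : Odd m := Nat.odd_iff.mpr (by omega)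
    haveI : NeZero (2 ^ (e - 1)) := ⟨pow_ne_zero _ two_ne_zero⟩
    -- the kernel element `z` and the kernel `{1, z}`
    have hker2 : ∀ v : (ZMod (2 ^ e))ˣ, ZMod.unitsMap hd v = 1 →
        (v : ZMod (2 ^ e)) = 1 ∨ (v : ZMod (2 ^ e)) = 1 + ((2 ^ (e - 1) : ℕ) : ZMod (2 ^ e)) :=
      fun v hv ↦ coe_eq_of_unitsMap_eq_one_double hd (by rw [← pow_succ]; congr 1; omega)
        (lt_of_lt_of_le one_lt_two (Nat.le_self_pow (by omega) 2)) v hv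
    obtain ⟨z, hz, hz1⟩ : ∃ z : (ZMod (2 ^ e))ˣ, ZMod.unitsMap hd z = 1 ∧ z ≠ 1 := by
      have hcard := totient_mul_card_ker (q := 2 ^ e) hd
      rw [Nat.totient_prime_pow Nat.prime_two (by omega),
        Nat.totient_prime_pow Nat.prime_two (by omega)] at hcard
      have hpow : 2 ^ (e - 1) = 2 ^ (e - 1 - 1) * 2 := by rw [← pow_succ]; congr 1; omega
      have h2 : #(univ.filter fun u : (ZMod (2 ^ e))ˣ ↦ ZMod.unitsMap hd u = 1) = 2 := by
        have hpos : 0 < 2 ^ (e - 1 - 1) := pow_pos (by norm_num) _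
        simp only [Nat.add_one_sub_one, mul_one] at hcard
        conv at hcard => rhs; rw [hpow]
        exact Nat.eq_of_mul_eq_mul_left hpos hcard
      obtain ⟨z, hzm, hz1⟩ := Finset.exists_mem_ne (s := univ.filter fun u : (ZMod (2 ^ e))ˣ ↦
        ZMod.unitsMap hd u = 1) (by rw [h2]; norm_num) 1
      simp only [Finset.mem_filter, Finset.mem_univ, true_and] at hzm
      exact ⟨z, hzm, hz1⟩
    have hz1' : (z : ZMod (2 ^ e)) ≠ 1 := fun h ↦ hz1 (Units.ext h)
    have hzval : (z : ZMod (2 ^ e)) = 1 + ((2 ^ (e - 1) : ℕ) : ZMod (2 ^ e)) := by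
      rcases hker2 z hz with h | h
      · exact absurd h hz1'
      · exact h
    have hker : ∀ v : (ZMod (2 ^ e))ˣ, ZMod.unitsMap hd v = 1 → v = 1 ∨ v = z := by
      intro v hv
      rcases hker2 v hv with h | h
      · exact Or.inl (Units.ext h)
      · exact Or.inr (Units.ext (h.trans hzval.symm))
    have hχz : ∀ χ₁ : DirichletCharacter ℂ (2 ^ e), χ₁.IsPrimitive → χ₁ z = -1 := by
      intro χ₁ h1
      have h4 : 4 ∣ 2 ^ e := by
        have := pow_dvd_pow 2 he2; rwa [show (2 : ℕ) ^ 2 = 4 by norm_num] at this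
      have hhalf : 2 ^ e / 2 = 2 ^ (e - 1) := by
        have := two_pow_mul_div_two (n := 1) (show 1 ≤ e by omega); simpa using this
      have := apply_one_add_half (N := 2 ^ e) h4 h1
      rwa [hhalf, ← hzval] at this
    by_cases hall : ∀ i, r i = r 0 ∨ r i = (z : ZMod (2 ^ e)) * r 0
    · by_cases hconc : ∀ i, r i = r 0
      · -- concentrated: every class is free (use `z`)
        refine freeCase fun i ↦ ⟨z, hz, fun j hj ↦ hz1' ?_⟩
        rw [hconc j, hconc i] at hj
        exact ((hru 0).mul_right_cancel (hj.symm.trans (one_mul _).symm))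
      · -- flips on the class `z r₀`
        set s' : Fin 4 → ℂ := fun i ↦ if r i = r 0 then s i else -s i with hs'def
        have hs' : ∀ i, s' i = 1 ∨ s' i = -1 := by
          intro i; simp only [hs'def]
          split_ifs
          · exact hs i
          · rcases hs i with h1 | h1 <;> rw [h1] <;> norm_num
        have hnull := quad_flip_null hcop hd hprim p s hT z hz hz1' hall
        exact quad_flip_finish hcop hd hdq z hz hz1' hker hχz p s hall s' (fun i ↦ rfl)
          (ih' _ s' hs' hnull)
    · push Not at hall
      obtain ⟨i, hi1, hi2⟩ := hall
      exact Or.inl (quad_split_of_two_cosets hcop hd hdq hprim hmval p s hs hT z hz hz1' hker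
        ⟨i, hi1, hi2⟩)
  · /- `pr = 3` -/
    subst hp3
    rcases Nat.lt_or_ge e 2 with he2 | he2
    · -- `3 ∥ N`: kernel `{1, -1}` = all units of `ℤ/3`
      have he1' : e = 1 := by omega
      subst he1'
      have hunits : ∀ v : (ZMod (3 ^ 1))ˣ, v = 1 ∨ v = -1 := by decide
      have hu : ZMod.unitsMap hd (-1) = 1 := unitsMap_eq_one_of_eq_one hd (by norm_num) _
      have hu1 : ((-1 : (ZMod (3 ^ 1))ˣ) : ZMod (3 ^ 1)) ≠ 1 := by decide
      have hker : ∀ v : (ZMod (3 ^ 1))ˣ, ZMod.unitsMap hd v = 1 → v = 1 ∨ v = -1 :=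
        fun v _ ↦ hunits v
      have hχu : ∀ χ₁ : DirichletCharacter ℂ (3 ^ 1), χ₁.IsPrimitive → χ₁ ((-1 : (ZMod (3 ^ 1))ˣ)) = -1 := by
        intro χ₁ h1
        have hne : χ₁ ≠ 1 := by
          intro h1'
          rw [h1', DirichletCharacter.isPrimitive_def, DirichletCharacter.conductor_one] at h1
          norm_num at h1
        have := odd_of_ne_one_of_units_eq hunits hne
        rw [Units.val_neg, Units.val_one]
        exact this
      -- every residue is `± r 0`
      have hall : ∀ i, r i = r 0 ∨ r i = ((-1 : (ZMod (3 ^ 1))ˣ) : ZMod (3 ^ 1)) * r 0 := by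
        intro i
        have hi := hunits (ZMod.unitsMap (dvd_mul_right (3 ^ 1) m) (p i))
        have h0 := hunits (ZMod.unitsMap (dvd_mul_right (3 ^ 1) m) (p 0))
        have hri : r i = ((ZMod.unitsMap (dvd_mul_right (3 ^ 1) m) (p i) : (ZMod (3 ^ 1))ˣ) :
          ZMod (3 ^ 1)) := (coe_unitsMap _ _).symm
        have hr0 : r 0 = ((ZMod.unitsMap (dvd_mul_right (3 ^ 1) m) (p 0) : (ZMod (3 ^ 1))ˣ) :
          ZMod (3 ^ 1)) := (coe_unitsMap _ _).symm
        rw [hri, hr0]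
        rcases hi with hi | hi <;> rcases h0 with h0 | h0 <;> rw [hi, h0]
        · exact Or.inl rfl
        · right; rw [← Units.val_mul]; norm_num
        · exact Or.inr (mul_one _).symm
        · exact Or.inl rfl
      by_cases hconc : ∀ i, r i = r 0
      · refine freeCase fun i ↦ ⟨-1, hu, fun j hj ↦ hu1 ?_⟩
        rw [hconc j, hconc i] at hj
        exact ((hru 0).mul_right_cancel (hj.symm.trans (one_mul _).symm))
      · set s' : Fin 4 → ℂ := fun i ↦ if r i = r 0 then s i else -s i with hs'def
        have hs' : ∀ i, s' i = 1 ∨ s' i = -1 := by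
          intro i; simp only [hs'def]
          split_ifs
          · exact hs i
          · rcases hs i with h1 | h1 <;> rw [h1] <;> norm_num
        have hnull := quad_flip_null hcop hd hprim p s hT (-1) hu hu1 hall
        exact quad_flip_finish hcop hd hdq (-1) hu hu1 hker hχu p s hall s' (fun i ↦ rfl)
          (ih' _ s' hs' hnull)
    · -- `9 ∣ N`: kernel of order `3`
      have hn9 : ¬ 9 ∣ m := fun h9 ↦ hpm (dvd_trans (by norm_num) h9)
      by_cases hfree : ∀ i, ∃ u : (ZMod (3 ^ e))ˣ, ZMod.unitsMap hd u = 1 ∧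
          ∀ j, r j ≠ (u : ZMod (3 ^ e)) * r i
      · exact freeCase hfree
      · exfalso
        push Not at hfree
        obtain ⟨i₀, hi₀⟩ := hfree
        obtain ⟨z, hz, hz1, -⟩ := exists_unit_one_add_primePow Nat.prime_three he2
          (fun h ↦ by
            have : (2 : ℕ) ∣ 3 ^ e := by rw [h]; norm_num
            exact absurd (Nat.Prime.dvd_of_dvd_pow Nat.prime_two this) (by norm_num))
        have hz1' : (z : ZMod (3 ^ e)) ≠ 1 := fun h ↦ hz1 (Units.ext h)
        have hz3 : z ^ 3 = 1 := by
          have := pow_card_ker_eq_one hd z hz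
          rwa [card_ker_primePow Nat.prime_three he2] at this
        exact quad_false_of_coset_three hcop hd hprim hmval hn9 p s hs hT z hz hz1' hz3 i₀
          (fun u hu ↦ hi₀ u hu)
  · /- `pr = 5`, `5 ∥ N`: all units of `ℤ/5` in the kernel -/
    subst hp5
    have he1' : e = 1 := by
      by_contra hne
      exact h25 (dvd_trans (by norm_num : 25 ∣ 5 ^ 2)
        (dvd_trans (pow_dvd_pow 5 (by omega : 2 ≤ e)) (dvd_mul_right _ _)))
    subst he1'
    by_cases hdist : ∀ i j, r i = r j → i = j
    · exact Or.inr (quad_five_terminal hcop p s hT hdist)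
    · -- some residue is repeated: every class is free by counting
      have hker5 : #(univ.filter fun u : (ZMod (5 ^ 1))ˣ ↦ ZMod.unitsMap hd u = 1) = 4 := by
        rw [Finset.filter_true_of_mem (fun u _ ↦ unitsMap_eq_one_of_eq_one hd (by norm_num) u),
          Finset.card_univ, ZMod.card_units_eq_totient]
        decide
      have himg : #(univ.image r) < 4 := by
        refine lt_of_le_of_ne hrimage fun h4 ↦ hdist ?_
        intro i j hij
        have hinj : Set.InjOn r (univ : Finset (Fin 4)) := by
          rw [← Finset.card_image_iff]; simpa using h4
        exact hinj (mem_univ _) (mem_univ _) hij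
      exact freeCase (exists_free_of_card_image_lt hd r hru (by rw [hker5]; exact himg))
  · /- the big kernel: at least five elements -/
    have hker5 : 5 ≤ #(univ.filter fun u : (ZMod (pr ^ e))ˣ ↦
        ZMod.unitsMap (pow_dvd_pow pr (Nat.sub_le e 1)) u = 1) := by
      rcases Nat.lt_or_ge e 2 with he2 | he2
      · have he1' : e = 1 := by omega
        subst he1'
        have hp5 : pr ≠ 5 := fun h ↦ by
          have := hpow2 5 Nat.prime_five h (by simpa using hp25 h); omega
        have hp7 : 7 ≤ pr := by
          by_contra hlt
          push Not at hlt
          interval_cases pr <;> (revert hp hp2 hp3 hp5; decide)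
        rw [Finset.filter_true_of_mem (fun u _ ↦ unitsMap_eq_one_of_eq_one _ (by simp) u),
          Finset.card_univ, ZMod.card_units_eq_totient, pow_one, Nat.totient_prime hp]
        omega
      · rw [card_ker_primePow hp he2]
        have hp5 : 5 ≤ pr := by
          by_contra hlt
          push Not at hlt
          interval_cases pr <;> (revert hp hp2 hp3; decide)
        exact hp5
    exact freeCase (exists_free_of_card_image_lt hd r hru (lt_of_le_of_lt hrimage hker5))

end Main

end FermatCharacter

end Literature.AlgebraicGeometry.HodgeTheory
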